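import Mathlib.Algebra.Algebra.Bilinear
import Mathlib.Algebra.Polynomial.Coeff
import Mathlib.Data.Matrix.Mul
import Mathlib.Tactic.Module
import Literature.Combinatorics.Sahi2008.Functional
import HarnessLib

/-!
# Sahi (2008): the FKG inequality for functions with values in a PARTIALLY ORDERED ALGEBRA

Topic `Literature/Probability/LatticeModels` (FKG-type inequalities; companions `FKGEquality.lean`,
`MTP2FKG.lean`, and `Literature/Combinatorics/Sahi2008/*` for Sahi's higher correlation functionals).

## Source (author's reprint, read 2026-08-20: `lit read https://sites.math.rutgers.edu/~sahi/Reprints/08fkgPOalgebras.pdf`,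
## journal pp. 449–456), verbatim

S. Sahi, *The FKG inequality for partially ordered algebras*, J. Theoret. Probab. **21** (2008) 449–458
[Sahi2008POAlgebras].

> (p. 449) "Let `2^S` be the lattice of all subsets of a finite set `S` … A function `f : 2^S → ℝ` is said to be
> increasing if `f(α) − f(β)` is positive for all `β ⊆ α`. (Here and elsewhere by a positive number we mean one
> which is `≥ 0`.)  Given a probability measure `μ` on `2^S` we define … `E_μ(f) := Σ_{α ∈ 2^S} μ(α) f(α)`,
> `C_μ(f,g) := E_μ(fg) − E_μ(f)E_μ(g)`.  The FKG inequality asserts if `f, g` are increasing, and `μ` satisfies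
> `μ(α ∪ β) μ(α ∩ β) ≥ μ(α) μ(β)` for all `α, β ⊆ S` (1) then one has `C_μ(f,g) ≥ 0`."
> (p. 450) "by an "algebra" we will mean an algebra over `ℝ` which is not necessarily associative, commutative
> or unital.  Also by a "convex cone" we will mean a non-empty subset of a vector space over `ℝ`, which is
> closed under addition and under multiplication by positive scalars.
> **Definition 1** A partially ordered algebra is a pair `(A,P)` where `A` is an algebra and `P` is a convex
> cone satisfying `x, y ∈ P ⇒ xy ∈ P`.  …  `C_μ(f,g) := E_μ(f · g) − E_μ(f) · E_μ(g)`, where `a · b = (ab + ba)/2`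
> denotes the anticommutator in `A`.
> **Theorem 2** Suppose `(A,P)` is a partially ordered algebra and `μ` satisfies (1). Then any two increasing
> functions `f, g : 2^S → A` have positive covariance."
> (p. 451) "**Theorem 4** For `(A,P)`, `μ`, `f` as above, the variance `V_μ(f)` is positive."
> (pp. 452–454, proof of Theorem 4) "`μ_x(α) := μ(α) + μ(αx)`,
> `f_x(α) := (μ(α)f(α) + μ(αx)f(αx))/μ_x(α)` if `μ_x(α) ≠ 0`, `0` if `μ_x(α) = 0`. … `E_{μ_x}(f_x) = E_μ(f)`.
> **Lemma 5** If `μ` is a probability measure satisfying (1), then so is `μ_x`.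
> **Lemma 6** If `μ` is an FKG measure and `f` is increasing on `supp(μ)`, then `f_x` is increasing on `supp(μ_x)`.
> *Proof (of Theorem 4)* We proceed by induction on `|S|` … it suffices to prove that `V_μ(f) − V_{μ_x}(f_x)`
> is positive … the expression becomes `(a₀a₁/(a₀ + a₁)) [f(αx) − f(α)]²` which is positive since `f` is
> increasing."
> (p. 454) "**Theorem 7** Suppose `(A,P)` is a partially ordered algebra, `μ` satisfies (1), and `f : 2^S → A` is
> an increasing function. Then the following expression is positive
> `Φ(μ,S,f) := Σ_{{ω,ωᶜ}} μ(ω) μ(ωᶜ) [f(ω) − f(ωᶜ)]²` (where the sum ranges over all unordered pairs of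
> complementary subsets of `S`.)"  (p. 455) "the previous result holds even if `μ` is not a probability
> measure, but merely a positive measure satisfying (1)".

## What is formalised (everything PROVED; no named facts; axioms standard)

* The setting: `IsPOCone P` (Definition 1: a convex cone `P ⊆ A`, `0 ∈ P`, closed under `+`, under
  nonnegative scalars and under products), for `A` a real algebra in Mathlib's non-unital non-associative sense
  (`[NonUnitalNonAssocRing A] [Module ℝ A] [SMulCommClass ℝ A A] [IsScalarTower ℝ A A]`); the anticommutator
  product `jordan u v = ½(uv + vu)`; `E_μ`, `C_μ` for `A`-valued functions on `2^S = Finset ι` (`exA`, `covA`);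
  `Increasing P f`, and Sahi's "increasing on the support" `IncreasingOn P μ f`.
* The collapse `μ_x`, `f_x` (`collapse`, `collapseFun`) with `E_{μ_x}(f_x) = E_μ(f)` (`exA_collapse`),
  **Lemma 5** (`collapse_fkg`, mass `sum_collapse`) and **Lemma 6** (`increasingOn_collapseFun`).
* **Theorem 2** (`sahi2008b_thm2`: `C_μ(f,g) ∈ P`) and **Theorem 4** (`sahi2008b_thm4`: `V_μ(f) ∈ P`), by
  the printed induction on `|S|` run for the COVARIANCE directly: the printed step identity
  `V_μ(f) − V_{μ_x}(f_x) = Σ_α (a₀a₁/(a₀+a₁))[f(αx) − f(α)]²` in its bilinear form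
  `C_μ(f,g) − C_{μ_x}(f_x,g_x) = Σ_α (a₀a₁/(a₀+a₁)) [f(αx) − f(α)]·[g(αx) − g(α)]` (`covA_eq_collapse_add`) —
  this replaces the polarisation through `A[x,y]` of p. 452 (documented deviation; same computation).
  The support version actually proved by Sahi is `covA_mem_of_increasingOn`.
* **Theorem 7** (`sahi2008b_thm7`, for positive FKG measures as remarked on p. 455), in the relative form
  `Φ(μ,T,f) = ½ Σ_{ω ⊆ T} μ(ω)μ(T∖ω)[f(ω) − f(T∖ω)]²` for any `T ⊆ S` (`phi`), via the printed auxiliary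
  measure `ν(ω) = μ(ω)μ(ωᶜ)/M` and `g = f − f∘ᶜ`.
* The two examples of p. 451: `A = ℝ[x]` with the cone of polynomials with nonnegative coefficients
  (`isPOCone_polynomial`), `A` = real matrices with the cone of entrywise nonnegative matrices (which
  preserve the positive orthant; `isPOCone_matrix`); and `A = ℝ` (`isPOCone_real`), where Theorem 2 is the
  classical FKG inequality on `2^S` (`fkg_real_of_thm2`).

* **Theorem 3** (`sahi2008b_thm3`, `sahi2008b_thm3'`): for `A` associative and commutative (here also
  unital — TODO(general form): non-unital), `f : 2^S → P` increasing and `g : 2^S → P` decreasing,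
  `E_μ(f²)E_μ(g²) − E_μ(fg)² ∈ P`; proof as printed — the Lagrange identity (`lagrange_identity`), grouping
  the pairs `(α,β)` by `(α ∩ β, α ∪ β)` (`sum_pairs_eq_sum_unionInter`), and Theorem 7 on `2^T`,
  `T = ω₁ ∖ ω₀`, for `ν(γ) = μ(γ ∪ ω₀)`, `h(γ) = f(γ ∪ ω₀)g(γᶜ ∪ ω₀)`; products of increasing `P`-valued
  functions are increasing (`increasing_mul`, the remark on p. 455).
* **§4**: the Ahlswede–Daykin four functions theorem FAILS over `(ℝ[x], nonnegative coefficients)`, by the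
  printed four functions on `2^S`, `|S| = 1` (`sahi2008b_ahlswedeDaykin_fails`:
  `(Σa)(Σb) − (Σc)(Σd) = x³ + x² − x + 1 ∉ P`).

* **Marginals and conditional expectations** (`marg`, `cexp`: [Richards2004, (2.2)–(2.4)], following
  den Hollander–Keane (1986)), indexed by the set `C = A ∖ B` of coordinates integrated out: the tower property
  `μ_{A∖(C∪x)} = (μ_{A∖C})_x`, `f_{A∖(C∪x)} = (f_{A∖C})_x` (`marg_insert`, `cexp_insert` — Sahi's collapse,
  iterated), `μ_B` is MTP₂ (`marg_fkg`), `f_B` is increasing on the support (`increasingOn_cexp`), the double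
  expectation theorem `E(f) = E_B(f_B)` (`exA_marg_cexp`), and **den Hollander–Keane's Theorem 4(b)** as
  reported in [Richards2004, Rem. 2.3]: `E(f₁f₂) − E_B(f_{1B} f_{2B})` is decreasing in `B` — proved here for
  `(A,P)`-valued `f, g` by Sahi's step identity applied to `μ_B` (`exA_marg_cexp_mono`; the printed real case
  `denHollanderKeane_thm4b`); its end values are `C_μ(f,g)` (`B = ∅`) and `0` (`B = A`) (`covA_eq_exA_marg_sub`).
  The primary [DenhollanderKeane1986] (Physica A 138) is paywalled and was NOT read (acq-07972); its Theorem 4(b)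
  is cited through Richards' report, p. 1518.

Not formalised here: the remarks that Theorems 4 and 7 only need `P` closed under squares.
Motivation: crux `stmt-CriticalPhenomena-4575` (cell prim-sahi) — Sahi's sequel to [Sahi2008] named in the
cell's reading list; for `A = ℝ[[t]]` with the nonnegative-coefficient cone this is the FKG layer (`n = 2`) of
the power-series cone `𝒫` of [Sahi2008] for EVERY FKG measure.
-/

noncomputable section

namespace Literature.Probability.LatticeModels

namespace POAlgebra

open Finset

/-! ### Definition 1: partially ordered algebras -/

section Cone

variable {A : Type*} [NonUnitalNonAssocRing A] [Module ℝ A]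

/-- **Definition 1 (partially ordered algebra).**  `P ⊆ A` is a convex cone — contains `0`, closed under
addition and under multiplication by positive (`≥ 0`) scalars — with `x, y ∈ P ⇒ xy ∈ P`.  The elements of
`P` are called positive. [cite: Sahi2008POAlgebras, Def. 1 (p. 450)] -/
structure IsPOCone (P : Set A) : Prop where
  /-- `0` is positive (the cone is non-empty and closed under the scalar `0`) -/
  zero_mem : (0 : A) ∈ P
  /-- closed under addition -/
  add_mem : ∀ {u v : A}, u ∈ P → v ∈ P → u + v ∈ P
  /-- closed under nonnegative scalars -/
  smul_mem : ∀ {c : ℝ} {u : A}, 0 ≤ c → u ∈ P → c • u ∈ P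
  /-- closed under products -/
  mul_mem : ∀ {u v : A}, u ∈ P → v ∈ P → u * v ∈ P

variable {P : Set A}

/-- Finite sums of positive elements are positive. [cite: Sahi2008POAlgebras, Def. 1 (p. 450)] -/
theorem IsPOCone.sum_mem (hP : IsPOCone P) {κ : Type*} {s : Finset κ} {h : κ → A}
    (hs : ∀ i ∈ s, h i ∈ P) : ∑ i ∈ s, h i ∈ P := by
  classical
  induction s using Finset.induction_on with
  | empty => simpa using hP.zero_mem
  | insert a s ha ih =>
    rw [sum_insert ha]
    exact hP.add_mem (hs a (mem_insert_self a s)) (ih fun i hi => hs i (mem_insert_of_mem hi))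

/-- A nonnegative multiple of an element that is positive whenever the multiple is nonzero is positive.
[cite: Sahi2008POAlgebras, Def. 1 (p. 450)] -/
theorem IsPOCone.smul_mem_of_ne (hP : IsPOCone P) {c : ℝ} {u : A} (hc : 0 ≤ c) (hu : c ≠ 0 → u ∈ P) :
    c • u ∈ P := by
  by_cases h : c = 0
  · rw [h, zero_smul]; exact hP.zero_mem
  · exact hP.smul_mem hc (hu h)

/-- Differences telescope inside the cone: `u − w = (u − v) + (v − w)`. [cite: Sahi2008POAlgebras, Def. 1 (p. 450)] -/
theorem IsPOCone.sub_mem_trans (hP : IsPOCone P) {u v w : A} (h₁ : u - v ∈ P) (h₂ : v - w ∈ P) :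
    u - w ∈ P := by
  have : u - w = (u - v) + (v - w) := by abel
  rw [this]; exact hP.add_mem h₁ h₂

end Cone

/-! ### The anticommutator product, `E_μ` and `C_μ` for `A`-valued functions -/

section Algebra

variable {A : Type*} [NonUnitalNonAssocRing A] [Module ℝ A] [SMulCommClass ℝ A A] [IsScalarTower ℝ A A]

/-- **The anticommutator product `a · b = (ab + ba)/2`** as an `ℝ`-bilinear map.
[cite: Sahi2008POAlgebras, §1 (p. 450)] -/
def jordan : A →ₗ[ℝ] A →ₗ[ℝ] A :=
  (1 / 2 : ℝ) • (LinearMap.mul ℝ A + (LinearMap.mul ℝ A).flip)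

/-- `a · b = ½(ab + ba)`. [cite: Sahi2008POAlgebras, §1 (p. 450)] -/
theorem jordan_apply (u v : A) : jordan u v = (1 / 2 : ℝ) • (u * v + v * u) := by
  simp [jordan]

/-- The anticommutator product is commutative. [cite: Sahi2008POAlgebras, §1 (p. 450)] -/
theorem jordan_comm (u v : A) : jordan u v = jordan v u := by
  rw [jordan_apply, jordan_apply, add_comm]

/-- `a · a = a²`. [cite: Sahi2008POAlgebras, §2 (p. 451: "the variance `V_μ(f) = C_μ(f,f) = E_μ(f²) − E_μ(f)²`") ] -/
theorem jordan_self (u : A) : jordan u u = u * u := by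
  rw [jordan_apply, ← two_smul ℝ (u * u), smul_smul]
  norm_num

variable {P : Set A}

/-- The anticommutator product of two positive elements is positive. [cite: Sahi2008POAlgebras, Def. 1 (p. 450)] -/
theorem IsPOCone.jordan_mem (hP : IsPOCone P) {u v : A} (hu : u ∈ P) (hv : v ∈ P) : jordan u v ∈ P := by
  rw [jordan_apply]
  exact hP.smul_mem (by norm_num) (hP.add_mem (hP.mul_mem hu hv) (hP.mul_mem hv hu))

variable {ι : Type*} [Fintype ι] [DecidableEq ι]

/-- **`E_μ(f) := Σ_α μ(α) f(α)`** for an `A`-valued `f` on `2^S`. [cite: Sahi2008POAlgebras, §1 (p. 449–450)] -/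
def exA (μ : Finset ι → ℝ) (f : Finset ι → A) : A :=
  ∑ α, μ α • f α

/-- **`C_μ(f,g) := E_μ(f · g) − E_μ(f) · E_μ(g)`** with the anticommutator product.
[cite: Sahi2008POAlgebras, §1 (p. 450)] -/
def covA (μ : Finset ι → ℝ) (f g : Finset ι → A) : A :=
  exA μ (fun α => jordan (f α) (g α)) - jordan (exA μ f) (exA μ g)

/-- **`V_μ(f) = C_μ(f,f)`**, the variance. [cite: Sahi2008POAlgebras, §2 (p. 451)] -/
def varA (μ : Finset ι → ℝ) (f : Finset ι → A) : A :=
  covA μ f f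

/-- **Increasing** `A`-valued function: `f(α) − f(β) ∈ P` for all `β ⊆ α`. [cite: Sahi2008POAlgebras, §1 (p. 449–450)] -/
def Increasing (P : Set A) (f : Finset ι → A) : Prop :=
  ∀ ⦃α β : Finset ι⦄, β ⊆ α → f α - f β ∈ P

/-- **Increasing on the support of `μ`** (the hypothesis actually carried through the induction, p. 452: "we
shall prove the positive variance theorem under the weaker (but equivalent) assumption that `f` is increasing
on the support of `μ`"). [cite: Sahi2008POAlgebras, §2 (p. 452)] -/
def IncreasingOn (P : Set A) (μ : Finset ι → ℝ) (f : Finset ι → A) : Prop :=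
  ∀ ⦃α β : Finset ι⦄, μ α ≠ 0 → μ β ≠ 0 → β ⊆ α → f α - f β ∈ P

omit [Module ℝ A] [SMulCommClass ℝ A A] [IsScalarTower ℝ A A] [Fintype ι] [DecidableEq ι] in
/-- Increasing functions are increasing on every support. [cite: Sahi2008POAlgebras, §2 (p. 452)] -/
theorem Increasing.increasingOn {f : Finset ι → A} (hf : Increasing P f) (μ : Finset ι → ℝ) :
    IncreasingOn P μ f :=
  fun _ _ _ _ h => hf h

omit [DecidableEq ι] in
/-- `V_μ(f) = E_μ(f²) − E_μ(f)²`. [cite: Sahi2008POAlgebras, §2 (p. 451)] -/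
theorem varA_eq (μ : Finset ι → ℝ) (f : Finset ι → A) :
    varA μ f = exA μ (fun α => f α * f α) - exA μ f * exA μ f := by
  simp only [varA, covA, jordan_self]

/-! ### Splitting sums over `2^S` at a coordinate `x` -/

omit [Fintype ι] in
/-- `insert x` is injective on the sets not containing `x`. [folklore] -/
private theorem insert_injOn (x : ι) {β₁ : Finset ι} (h₁ : x ∉ β₁) {β₂ : Finset ι} (h₂ : x ∉ β₂)
    (h : insert x β₁ = insert x β₂) : β₁ = β₂ := by
  rw [← erase_insert h₁, h, erase_insert h₂]

/-- The sets containing `x` are the `insert x β`, `x ∉ β`. [folklore] -/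
private theorem filter_mem_eq_image (x : ι) :
    (univ.filter fun α : Finset ι => x ∈ α) = (univ.filter fun β : Finset ι => x ∉ β).image (insert x) := by
  ext α
  simp only [mem_filter, mem_univ, true_and, mem_image]
  constructor
  · intro hx
    exact ⟨α.erase x, notMem_erase x α, insert_erase hx⟩
  · rintro ⟨β, -, rfl⟩
    exact mem_insert_self x β

/-- **Splitting a sum over `2^S` along `x`**: `Σ_α g(α) = Σ_{β ∌ x} [g(β) + g(βx)]`. [folklore] -/
private theorem sum_split {M : Type*} [AddCommMonoid M] (x : ι) (g : Finset ι → M) :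
    ∑ α, g α = ∑ β ∈ univ.filter (fun β : Finset ι => x ∉ β), (g β + g (insert x β)) := by
  rw [sum_add_distrib, ← sum_filter_add_sum_filter_not univ (fun β : Finset ι => x ∉ β)]
  congr 1
  have h1 : (univ.filter fun β : Finset ι => ¬x ∉ β) = univ.filter fun α : Finset ι => x ∈ α :=
    filter_congr fun α _ => not_not
  rw [h1, filter_mem_eq_image x, sum_image]
  intro β₁ h₁ β₂ h₂ h
  exact insert_injOn x (mem_filter.1 h₁).2 (mem_filter.1 h₂).2 h

/-! ### The collapse `μ_x`, `f_x` (pp. 452–453) -/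

/-- **`μ_x(α) := μ(α) + μ(αx)`** for `α ⊆ S ∖ {x}`, as a weight on `2^S` vanishing on the sets containing `x`.
[cite: Sahi2008POAlgebras, §2 (p. 452)] -/
def collapse (μ : Finset ι → ℝ) (x : ι) (β : Finset ι) : ℝ :=
  if x ∈ β then 0 else μ β + μ (insert x β)

/-- **`f_x(α) := (μ(α)f(α) + μ(αx)f(αx))/μ_x(α)`** if `μ_x(α) ≠ 0`, and `0` otherwise.
[cite: Sahi2008POAlgebras, §2 (p. 452)] -/
def collapseFun (μ : Finset ι → ℝ) (f : Finset ι → A) (x : ι) (β : Finset ι) : A :=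
  if collapse μ x β = 0 then 0
  else (collapse μ x β)⁻¹ • (μ β • f β + μ (insert x β) • f (insert x β))

omit [Fintype ι] in
/-- `μ_x` vanishes on sets containing `x`. [cite: Sahi2008POAlgebras, §2 (p. 452)] -/
@[simp] theorem collapse_of_mem {μ : Finset ι → ℝ} {x : ι} {β : Finset ι} (h : x ∈ β) :
    collapse μ x β = 0 := by
  simp [collapse, h]

omit [Fintype ι] in
/-- `μ_x(β) = μ(β) + μ(βx)` for `x ∉ β`. [cite: Sahi2008POAlgebras, §2 (p. 452)] -/
theorem collapse_of_not_mem {μ : Finset ι → ℝ} {x : ι} {β : Finset ι} (h : x ∉ β) :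
    collapse μ x β = μ β + μ (insert x β) := by
  simp [collapse, h]

omit [Fintype ι] in
/-- `μ_x ≥ 0`. [cite: Sahi2008POAlgebras, Lemma 5 (p. 452)] -/
theorem collapse_nonneg {μ : Finset ι → ℝ} (hμ0 : ∀ α, 0 ≤ μ α) (x : ι) (β : Finset ι) :
    0 ≤ collapse μ x β := by
  unfold collapse
  split_ifs
  · exact le_rfl
  · exact add_nonneg (hμ0 _) (hμ0 _)

omit [Fintype ι] in
/-- For `x ∉ β`: `μ_x(β) = 0` iff `μ(β) = μ(βx) = 0` ("for then `μ(αx) = μ(α) = 0` as well", p. 454).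
[cite: Sahi2008POAlgebras, §2 (p. 454)] -/
theorem collapse_eq_zero_iff {μ : Finset ι → ℝ} (hμ0 : ∀ α, 0 ≤ μ α) {x : ι} {β : Finset ι} (h : x ∉ β) :
    collapse μ x β = 0 ↔ μ β = 0 ∧ μ (insert x β) = 0 := by
  rw [collapse_of_not_mem h]
  constructor
  · intro h0
    have h1 := hμ0 β
    have h2 := hμ0 (insert x β)
    constructor <;> linarith
  · rintro ⟨h1, h2⟩
    rw [h1, h2, add_zero]

/-- **`μ_x` has the same total mass as `μ`** (so it is a probability measure when `μ` is).
[cite: Sahi2008POAlgebras, Lemma 5 (p. 452)] -/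
theorem sum_collapse (μ : Finset ι → ℝ) (x : ι) : ∑ β, collapse μ x β = ∑ α, μ α := by
  rw [sum_split x μ, ← sum_filter_add_sum_filter_not univ (fun β : Finset ι => x ∉ β) (collapse μ x)]
  have h0 : ∑ β ∈ univ.filter (fun β : Finset ι => ¬x ∉ β), collapse μ x β = 0 :=
    sum_eq_zero fun β hβ => collapse_of_mem (not_not.1 (mem_filter.1 hβ).2)
  rw [h0, add_zero]
  exact sum_congr rfl fun β hβ => collapse_of_not_mem (mem_filter.1 hβ).2

omit [SMulCommClass ℝ A A] [IsScalarTower ℝ A A] in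
/-- **`E_{μ_x}(f_x) = E_μ(f)`** (for `μ ≥ 0`). [cite: Sahi2008POAlgebras, §2 (p. 452)] -/
theorem exA_collapse {μ : Finset ι → ℝ} (hμ0 : ∀ α, 0 ≤ μ α) (f : Finset ι → A) (x : ι) :
    exA (collapse μ x) (collapseFun μ f x) = exA μ f := by
  unfold exA
  rw [sum_split x (fun α => μ α • f α),
    ← sum_filter_add_sum_filter_not univ (fun β : Finset ι => x ∉ β)
      (fun β => collapse μ x β • collapseFun μ f x β)]
  have h0 : ∑ β ∈ univ.filter (fun β : Finset ι => ¬x ∉ β),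
      collapse μ x β • collapseFun μ f x β = 0 :=
    sum_eq_zero fun β hβ => by rw [collapse_of_mem (not_not.1 (mem_filter.1 hβ).2), zero_smul]
  rw [h0, add_zero]
  refine sum_congr rfl fun β hβ => ?_
  have hx : x ∉ β := (mem_filter.1 hβ).2
  unfold collapseFun
  split_ifs with hc
  · obtain ⟨h1, h2⟩ := (collapse_eq_zero_iff hμ0 hx).1 hc
    rw [smul_zero, h1, h2, zero_smul, zero_smul, add_zero]
  · rw [smul_smul, mul_inv_cancel₀ hc, one_smul]

omit [Fintype ι] in
/-- An instance of the lattice condition (1): for `x ∉ α ⊇ β`, `μ(α)μ(βx) ≤ μ(β)μ(αx)` (the sets `α` and `βx`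
have union `αx` and intersection `β`). [cite: Sahi2008POAlgebras, Lemma 6, proof (p. 453: "By the FKG condition on `μ`, we have `a₁b₀ ≥ a₀b₁`") ] -/
theorem fkg_insert {μ : Finset ι → ℝ} (hμ : ∀ a b : Finset ι, μ a * μ b ≤ μ (a ∩ b) * μ (a ∪ b))
    {x : ι} {α β : Finset ι} (hx : x ∉ α) (hβα : β ⊆ α) :
    μ α * μ (insert x β) ≤ μ β * μ (insert x α) := by
  have h := hμ α (insert x β)
  have h1 : α ∩ insert x β = β := by
    rw [inter_insert_of_notMem hx, inter_eq_right.2 hβα]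
  have h2 : α ∪ insert x β = insert x α := by
    rw [union_insert, union_eq_left.2 hβα]
  rwa [h1, h2] at h

omit [Fintype ι] in
/-- **Lemma 5** (the lattice condition (1) passes to `μ_x`).  [Sahi: "Although this is well known (see e.g.
[7]) we reproduce the calculation"; we follow his calculation: `c₀d₀ ≥ a₀b₀`, `c₁d₁ ≥ a₁b₁`,
`c₁d₀ ≥ a₁b₀, a₀b₁`, and `c₁d₀ − a₁b₀ − a₀b₁ + c₀d₁ ≥ (1 − a₁b₀/(c₁d₀))(c₁d₀ − a₀b₁) ≥ 0`.]
[cite: Sahi2008POAlgebras, Lemma 5 (pp. 452–453)] -/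
theorem collapse_fkg {μ : Finset ι → ℝ} (hμ0 : ∀ α, 0 ≤ μ α)
    (hμ : ∀ a b : Finset ι, μ a * μ b ≤ μ (a ∩ b) * μ (a ∪ b)) (x : ι) (a b : Finset ι) :
    collapse μ x a * collapse μ x b ≤ collapse μ x (a ∩ b) * collapse μ x (a ∪ b) := by
  by_cases ha : x ∈ a
  · rw [collapse_of_mem ha, zero_mul]
    exact mul_nonneg (collapse_nonneg hμ0 x _) (collapse_nonneg hμ0 x _)
  by_cases hb : x ∈ b
  · rw [collapse_of_mem hb, mul_zero]
    exact mul_nonneg (collapse_nonneg hμ0 x _) (collapse_nonneg hμ0 x _)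
  have hd : x ∉ a ∩ b := fun h => ha (mem_inter.1 h).1
  have hc : x ∉ a ∪ b := fun h => (mem_union.1 h).elim ha hb
  rw [collapse_of_not_mem ha, collapse_of_not_mem hb, collapse_of_not_mem hd, collapse_of_not_mem hc]
  -- Sahi's `a₀ … d₁`
  set a0 := μ a; set a1 := μ (insert x a); set b0 := μ b; set b1 := μ (insert x b)
  set c0 := μ (a ∪ b); set c1 := μ (insert x (a ∪ b)); set d0 := μ (a ∩ b); set d1 := μ (insert x (a ∩ b))
  -- (2): the four instances of the lattice condition
  have h00 : a0 * b0 ≤ d0 * c0 := hμ a b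
  have h11 : a1 * b1 ≤ d1 * c1 := by
    have h := hμ (insert x a) (insert x b)
    rwa [← insert_inter_distrib, ← insert_union_distrib] at h
  have h10 : a1 * b0 ≤ d0 * c1 := by
    have h := hμ (insert x a) b
    rwa [insert_inter_of_notMem hb, insert_union] at h
  have h01 : a0 * b1 ≤ d0 * c1 := by
    have h := hμ a (insert x b)
    rwa [inter_insert_of_notMem ha, union_insert] at h
  have ha0 : 0 ≤ a0 := hμ0 _; have ha1 : 0 ≤ a1 := hμ0 _; have hb0 : 0 ≤ b0 := hμ0 _
  have hb1 : 0 ≤ b1 := hμ0 _; have hc0 : 0 ≤ c0 := hμ0 _; have hc1 : 0 ≤ c1 := hμ0 _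
  have hd0 : 0 ≤ d0 := hμ0 _; have hd1 : 0 ≤ d1 := hμ0 _
  -- the third bracket `c₁d₀ + c₀d₁ − a₁b₀ − a₀b₁ ≥ 0`
  have h3 : a1 * b0 + a0 * b1 ≤ c1 * d0 + c0 * d1 := by
    by_cases hcd : c1 * d0 = 0
    · -- then `a₁b₀ = a₀b₁ = 0` and the bracket is `c₀d₁ ≥ 0`
      have e1 : a1 * b0 = 0 := le_antisymm (by linarith) (mul_nonneg ha1 hb0)
      have e2 : a0 * b1 = 0 := le_antisymm (by linarith) (mul_nonneg ha0 hb1)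
      rw [e1, e2, hcd]
      linarith [mul_nonneg hc0 hd1]
    · have hpos : 0 < c1 * d0 := lt_of_le_of_ne (mul_nonneg hc1 hd0) (Ne.symm hcd)
      -- `c₁d₀ (c₁d₀ + c₀d₁ − a₁b₀ − a₀b₁) ≥ (c₁d₀ − a₁b₀)(c₁d₀ − a₀b₁) ≥ 0`
      have hprod : a0 * b0 * (a1 * b1) ≤ d0 * c0 * (d1 * c1) :=
        mul_le_mul h00 h11 (mul_nonneg ha1 hb1) (mul_nonneg hd0 hc0)
      have key : (c1 * d0 - a1 * b0) * (c1 * d0 - a0 * b1) ≤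
          c1 * d0 * (c1 * d0 + c0 * d1 - a1 * b0 - a0 * b1) := by nlinarith [hprod]
      have hnn : 0 ≤ (c1 * d0 - a1 * b0) * (c1 * d0 - a0 * b1) :=
        mul_nonneg (by linarith) (by linarith)
      have hbr : 0 ≤ c1 * d0 + c0 * d1 - a1 * b0 - a0 * b1 := by
        by_contra hlt
        have hneg : c1 * d0 * (c1 * d0 + c0 * d1 - a1 * b0 - a0 * b1) < 0 :=
          mul_neg_of_pos_of_neg hpos (not_le.1 hlt)
        linarith [hnn.trans key]
      linarith
  nlinarith [mul_nonneg ha0 hb0, mul_nonneg ha1 hb1]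

omit [Fintype ι] in
/-- `μ_x` is supported below `L` when `μ` is supported below `L ∪ {x}`. [cite: Sahi2008POAlgebras, §2 (p. 452)] -/
theorem collapse_supp {μ : Finset ι → ℝ} {x : ι} {L : Finset ι} (hsupp : ∀ α, μ α ≠ 0 → α ⊆ insert x L)
    {β : Finset ι} (hβ : collapse μ x β ≠ 0) : β ⊆ L := by
  have hx : x ∉ β := fun h => hβ (collapse_of_mem h)
  rw [collapse_of_not_mem hx] at hβ
  have hsub : β ⊆ insert x L := by
    by_cases h1 : μ β = 0
    · have h2 : μ (insert x β) ≠ 0 := fun h2 => hβ (by rw [h1, h2, add_zero])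
      exact (subset_insert x β).trans (hsupp _ h2)
    · exact hsupp _ h1
  intro y hy
  have hy' := hsub hy
  rcases mem_insert.1 hy' with rfl | h
  · exact absurd hy hx
  · exact h

omit [SMulCommClass ℝ A A] [IsScalarTower ℝ A A] [Fintype ι] in
/-- **Lemma 6**: if `μ ≥ 0` satisfies (1) and `f` is increasing on `supp(μ)`, then `f_x` is increasing on
`supp(μ_x)`.  [Printed computation: `μ_x(α)μ_x(β)[f_x(α) − f_x(β)] = a₁b₁[f(αx) − f(βx)] + a₀b₀[f(α) − f(β)]
+ a₁b₀[f(αx) − f(β)] + a₀b₁[f(α) − f(βx)]`, the last two terms regrouped using `a₁b₀ ≥ a₀b₁`.]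
[cite: Sahi2008POAlgebras, Lemma 6 (p. 453)] -/
theorem increasingOn_collapseFun (hP : IsPOCone P) {μ : Finset ι → ℝ} (hμ0 : ∀ α, 0 ≤ μ α)
    (hμ : ∀ a b : Finset ι, μ a * μ b ≤ μ (a ∩ b) * μ (a ∪ b)) {f : Finset ι → A}
    (hf : IncreasingOn P μ f) (x : ι) : IncreasingOn P (collapse μ x) (collapseFun μ f x) := by
  intro α β hα hβ hβα
  have hxα : x ∉ α := fun h => hα (collapse_of_mem h)
  have hxβ : x ∉ β := fun h => hβ (collapse_of_mem h)
  -- Sahi's `a₀ = μ α`, `a₁ = μ(αx)`, `b₀ = μ β`, `b₁ = μ(βx)`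
  have ha0 := hμ0 α; have ha1 := hμ0 (insert x α); have hb0 := hμ0 β; have hb1 := hμ0 (insert x β)
  have hcα : collapse μ x α = μ α + μ (insert x α) := collapse_of_not_mem hxα
  have hcβ : collapse μ x β = μ β + μ (insert x β) := collapse_of_not_mem hxβ
  have hA : μ α + μ (insert x α) ≠ 0 := by rwa [hcα] at hα
  have hB : μ β + μ (insert x β) ≠ 0 := by rwa [hcβ] at hβ
  have hfkg : μ α * μ (insert x β) ≤ μ β * μ (insert x α) := fkg_insert hμ hxα hβα
  -- the numerator `T = μ_x(α)μ_x(β)[f_x(α) − f_x(β)]`, regrouped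
  obtain ⟨T, hT⟩ : ∃ T : A, T =
      (μ (insert x α) * μ (insert x β)) • (f (insert x α) - f (insert x β)) + (μ α * μ β) • (f α - f β) +
      (μ α * μ (insert x β)) • ((f (insert x α) - f (insert x β)) + (f α - f β)) +
      (μ β * μ (insert x α) - μ α * μ (insert x β)) • (f (insert x α) - f β) := ⟨_, rfl⟩
  have hTeq : (μ β + μ (insert x β)) • (μ α • f α + μ (insert x α) • f (insert x α)) -
      (μ α + μ (insert x α)) • (μ β • f β + μ (insert x β) • f (insert x β)) = T := by
    rw [hT]
    module
  -- positivity of `T`, term by term (a vanishing coefficient kills its term)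
  have hxx : insert x β ⊆ insert x α := insert_subset_insert x hβα
  have hβxα : β ⊆ insert x α := hβα.trans (subset_insert x α)
  have hTpos : T ∈ P := by
    rw [hT]
    refine hP.add_mem (hP.add_mem (hP.add_mem ?_ ?_) ?_) ?_
    · refine hP.smul_mem_of_ne (mul_nonneg ha1 hb1) fun h => hf ?_ ?_ hxx
      · exact fun h1 => h (by rw [h1, zero_mul])
      · exact fun h1 => h (by rw [h1, mul_zero])
    · refine hP.smul_mem_of_ne (mul_nonneg ha0 hb0) fun h => hf ?_ ?_ hβα
      · exact fun h1 => h (by rw [h1, zero_mul])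
      · exact fun h1 => h (by rw [h1, mul_zero])
    · refine hP.smul_mem_of_ne (mul_nonneg ha0 hb1) fun h => ?_
      -- `a₀b₁ ≠ 0` forces `a₁b₀ ≥ a₀b₁ > 0`, so all four sets lie in the support
      have h01 : 0 < μ α * μ (insert x β) := lt_of_le_of_ne (mul_nonneg ha0 hb1) (Ne.symm h)
      have h10 : 0 < μ β * μ (insert x α) := lt_of_lt_of_le h01 hfkg
      have hna0 : μ α ≠ 0 := fun h1 => h (by rw [h1, zero_mul])
      have hnb1 : μ (insert x β) ≠ 0 := fun h1 => h (by rw [h1, mul_zero])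
      have hnb0 : μ β ≠ 0 := fun h1 => by rw [h1, zero_mul] at h10; exact lt_irrefl _ h10
      have hna1 : μ (insert x α) ≠ 0 := fun h1 => by rw [h1, mul_zero] at h10; exact lt_irrefl _ h10
      exact hP.add_mem (hf hna1 hnb1 hxx) (hf hna0 hnb0 hβα)
    · refine hP.smul_mem_of_ne (by linarith) fun h => ?_
      have h10 : 0 < μ β * μ (insert x α) := by
        have : μ α * μ (insert x β) < μ β * μ (insert x α) :=
          lt_of_le_of_ne hfkg fun h1 => h (by rw [h1, sub_self])
        exact lt_of_le_of_lt (mul_nonneg ha0 hb1) this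
      have hnb0 : μ β ≠ 0 := fun h1 => by rw [h1, zero_mul] at h10; exact lt_irrefl _ h10
      have hna1 : μ (insert x α) ≠ 0 := fun h1 => by rw [h1, mul_zero] at h10; exact lt_irrefl _ h10
      exact hf hna1 hnb0 hβxα
  -- `f_x(α) − f_x(β) = ((a₀+a₁)(b₀+b₁))⁻¹ • T`
  have hdiff : collapseFun μ f x α - collapseFun μ f x β =
      ((μ α + μ (insert x α)) * (μ β + μ (insert x β)))⁻¹ • T := by
    unfold collapseFun
    rw [if_neg hα, if_neg hβ, hcα, hcβ, ← hTeq, smul_sub, mul_inv, smul_smul, smul_smul,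
      inv_mul_cancel_right₀ hB, mul_right_comm, inv_mul_cancel₀ hA, one_mul]
  rw [hdiff]
  exact hP.smul_mem (inv_nonneg.2 (mul_nonneg (add_nonneg ha0 ha1) (add_nonneg hb0 hb1))) hTpos

/-! ### The induction step: `C_μ(f,g) − C_{μ_x}(f_x,g_x)` (proof of Theorem 4, bilinear form) -/

/-- The step term `(a₀a₁/(a₀+a₁)) [f(αx) − f(α)]·[g(αx) − g(α)]` at `β = α ⊆ S ∖ x` (and `0` off the support).
[cite: Sahi2008POAlgebras, proof of Thm. 4 (p. 454)] -/
def stepTerm (μ : Finset ι → ℝ) (f g : Finset ι → A) (x : ι) (β : Finset ι) : A :=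
  if x ∈ β then 0
  else (μ β * μ (insert x β) / (μ β + μ (insert x β))) •
    jordan (f (insert x β) - f β) (g (insert x β) - g β)

/-- The bilinear identity behind the last display on p. 454:
`(b₀F₀ + b₁F₁)·(b₀G₀ + b₁G₁) + b₀b₁ (F₁ − F₀)·(G₁ − G₀) = (b₀ + b₁)(b₀ F₀·G₀ + b₁ F₁·G₁)`.
[cite: Sahi2008POAlgebras, proof of Thm. 4 (p. 454)] -/
private theorem jordan_collapse_identity (b0 b1 : ℝ) (F0 F1 G0 G1 : A) :
    jordan (b0 • F0 + b1 • F1) (b0 • G0 + b1 • G1) + (b0 * b1) • jordan (F1 - F0) (G1 - G0) =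
      (b0 + b1) • (b0 • jordan F0 G0 + b1 • jordan F1 G1) := by
  simp only [map_add, map_sub, map_smul, LinearMap.add_apply, LinearMap.sub_apply, LinearMap.smul_apply]
  module

/-- **`E_μ(f·g) = E_{μ_x}(f_x·g_x) + Σ_β (b₀b₁/(b₀+b₁)) [f(βx) − f(β)]·[g(βx) − g(β)]`** — the identity of the
proof of Theorem 4 (there with `f = g`: `V_μ(f) − V_{μ_x}(f_x) = Σ (a₀a₁/(a₀+a₁))[f(αx) − f(α)]²`), for `μ ≥ 0`.
[cite: Sahi2008POAlgebras, proof of Thm. 4 (p. 454)] -/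
theorem exA_jordan_eq_collapse_add {μ : Finset ι → ℝ} (hμ0 : ∀ α, 0 ≤ μ α) (f g : Finset ι → A) (x : ι) :
    exA μ (fun α => jordan (f α) (g α)) =
      exA (collapse μ x) (fun β => jordan (collapseFun μ f x β) (collapseFun μ g x β)) +
        ∑ β, stepTerm μ f g x β := by
  unfold exA
  rw [sum_split x (fun α => μ α • jordan (f α) (g α)), ← sum_add_distrib,
    ← sum_filter_add_sum_filter_not univ (fun β : Finset ι => x ∉ β)
      (fun β => collapse μ x β • jordan (collapseFun μ f x β) (collapseFun μ g x β) + stepTerm μ f g x β)]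
  have h0 : ∑ β ∈ univ.filter (fun β : Finset ι => ¬x ∉ β),
      (collapse μ x β • jordan (collapseFun μ f x β) (collapseFun μ g x β) + stepTerm μ f g x β) = 0 :=
    sum_eq_zero fun β hβ => by
      have hx : x ∈ β := not_not.1 (mem_filter.1 hβ).2
      rw [collapse_of_mem hx, zero_smul, zero_add, stepTerm, if_pos hx]
  rw [h0, add_zero]
  refine sum_congr rfl fun β hβ => ?_
  have hx : x ∉ β := (mem_filter.1 hβ).2
  rw [stepTerm, if_neg hx]
  by_cases hzero : collapse μ x β = 0
  · obtain ⟨h1, h2⟩ := (collapse_eq_zero_iff hμ0 hx).1 hzero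
    rw [hzero, zero_smul, zero_add, h1, h2, zero_smul, zero_smul, zero_mul, zero_div, zero_smul, add_zero]
  · have hne : μ β + μ (insert x β) ≠ 0 := by rwa [collapse_of_not_mem hx] at hzero
    unfold collapseFun
    rw [if_neg hzero, if_neg hzero, collapse_of_not_mem hx, map_smul, map_smul, LinearMap.smul_apply,
      smul_smul, smul_smul, mul_inv_cancel₀ hne, one_mul, div_eq_inv_mul, ← smul_smul, ← smul_add,
      jordan_collapse_identity, smul_smul, inv_mul_cancel₀ hne, one_smul]

/-- **`C_μ(f,g) = C_{μ_x}(f_x,g_x) + Σ_β (b₀b₁/(b₀+b₁)) [f(βx) − f(β)]·[g(βx) − g(β)]`** ("it suffices to prove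
that `V_μ(f) − V_{μ_x}(f_x)` is positive.  Since `E_{μ_x}(f_x)` is equal to `E_μ(f)`, we get …").
[cite: Sahi2008POAlgebras, proof of Thm. 4 (p. 454)] -/
theorem covA_eq_collapse_add {μ : Finset ι → ℝ} (hμ0 : ∀ α, 0 ≤ μ α) (f g : Finset ι → A) (x : ι) :
    covA μ f g = covA (collapse μ x) (collapseFun μ f x) (collapseFun μ g x) + ∑ β, stepTerm μ f g x β := by
  unfold covA
  rw [exA_jordan_eq_collapse_add hμ0 f g x, exA_collapse hμ0 f x, exA_collapse hμ0 g x]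
  abel

omit [Fintype ι] in
/-- Each step term is positive when `f, g` are increasing on `supp(μ)` ("which is positive since `f` is
increasing"). [cite: Sahi2008POAlgebras, proof of Thm. 4 (p. 454)] -/
theorem stepTerm_mem (hP : IsPOCone P) {μ : Finset ι → ℝ} (hμ0 : ∀ α, 0 ≤ μ α) {f g : Finset ι → A}
    (hf : IncreasingOn P μ f) (hg : IncreasingOn P μ g) (x : ι) (β : Finset ι) :
    stepTerm μ f g x β ∈ P := by
  unfold stepTerm
  split_ifs with hx
  · exact hP.zero_mem
  · refine hP.smul_mem_of_ne (div_nonneg (mul_nonneg (hμ0 _) (hμ0 _)) (add_nonneg (hμ0 _) (hμ0 _)))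
      fun h => ?_
    have h0 : μ β ≠ 0 := fun h1 => h (by rw [h1, zero_mul, zero_div])
    have h1 : μ (insert x β) ≠ 0 := fun h1 => h (by rw [h1, mul_zero, zero_div])
    exact hP.jordan_mem (hf h1 h0 (subset_insert x β)) (hg h1 h0 (subset_insert x β))

/-! ### Theorems 2 and 4 -/

/-- **Theorem 4 / Theorem 2 in the form carried through the induction** (p. 452): for a partially ordered
algebra `(A,P)`, a probability weight `μ ≥ 0` on `2^S` satisfying the lattice condition (1) and supported on
the subsets of `L`, and `f, g` increasing ON THE SUPPORT of `μ`, the covariance `C_μ(f,g)` is positive.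
Induction on `L` through the collapse `(μ_x, f_x, g_x)` (Lemmas 5, 6 and the step identity).
[cite: Sahi2008POAlgebras, Thm. 4 and its proof (pp. 451–454)] -/
theorem covA_mem_of_increasingOn (hP : IsPOCone P) (L : Finset ι) :
    ∀ (μ : Finset ι → ℝ), (∀ α, 0 ≤ μ α) → (∑ α, μ α = 1) →
      (∀ a b : Finset ι, μ a * μ b ≤ μ (a ∩ b) * μ (a ∪ b)) → (∀ α, μ α ≠ 0 → α ⊆ L) →
      ∀ (f g : Finset ι → A), IncreasingOn P μ f → IncreasingOn P μ g → covA μ f g ∈ P := by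
  induction L using Finset.induction_on with
  | empty =>
    intro μ hμ0 hμ1 _ hsupp f g _ _
    -- `S = ∅`: `μ = δ_∅` and the covariance vanishes
    have hz : ∀ α : Finset ι, α ≠ ∅ → μ α = 0 := fun α hα => by
      by_contra h
      exact hα (subset_empty.1 (hsupp α h))
    have hμe : μ ∅ = 1 := by
      rw [← hμ1, Finset.sum_eq_single ∅ (fun α _ hα => hz α hα) (fun h => absurd (mem_univ _) h)]
    have hE : ∀ h : Finset ι → A, exA μ h = h ∅ := fun h => by
      unfold exA
      rw [Finset.sum_eq_single ∅ (fun α _ hα => by rw [hz α hα, zero_smul])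
        (fun h => absurd (mem_univ _) h), hμe, one_smul]
    unfold covA
    rw [hE, hE, hE, sub_self]
    exact hP.zero_mem
  | insert x L hxL ih =>
    intro μ hμ0 hμ1 hμ hsupp f g hf hg
    rw [covA_eq_collapse_add hμ0 f g x]
    refine hP.add_mem ?_ (hP.sum_mem fun β _ => stepTerm_mem hP hμ0 hf hg x β)
    exact ih (collapse μ x) (collapse_nonneg hμ0 x) (by rw [sum_collapse, hμ1]) (collapse_fkg hμ0 hμ x)
      (fun β hβ => collapse_supp hsupp hβ) _ _ (increasingOn_collapseFun hP hμ0 hμ hf x)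
      (increasingOn_collapseFun hP hμ0 hμ hg x)

/-- **Theorem 2 (Sahi 2008): the FKG inequality for partially ordered algebras.**  If `(A,P)` is a partially
ordered algebra and `μ` is a probability measure on `2^S` with `μ(α ∪ β)μ(α ∩ β) ≥ μ(α)μ(β)`, then any two
increasing `f, g : 2^S → A` have positive covariance: `C_μ(f,g) = E_μ(f·g) − E_μ(f)·E_μ(g) ∈ P`
(`a·b = (ab+ba)/2`).  Here `μ` is an `IsFKGMeasure` on the lattice `Finset ι`.
[cite: Sahi2008POAlgebras, Thm. 2 (p. 450)] -/
theorem sahi2008b_thm2 (hP : IsPOCone P) {μ : Finset ι → ℝ}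
    (hμ : Literature.Combinatorics.Sahi2008.IsFKGMeasure μ) {f g : Finset ι → A} (hf : Increasing P f)
    (hg : Increasing P g) : covA μ f g ∈ P :=
  covA_mem_of_increasingOn hP univ μ hμ.nonneg hμ.sum_eq_one hμ.mul_le_mul (fun α _ => subset_univ α) f g
    (hf.increasingOn μ) (hg.increasingOn μ)

/-- **Theorem 4 (Sahi 2008): positive variance.**  `V_μ(f) = E_μ(f²) − E_μ(f)² ∈ P` for increasing
`f : 2^S → A`. [cite: Sahi2008POAlgebras, Thm. 4 (p. 451)] -/
theorem sahi2008b_thm4 (hP : IsPOCone P) {μ : Finset ι → ℝ}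
    (hμ : Literature.Combinatorics.Sahi2008.IsFKGMeasure μ) {f : Finset ι → A} (hf : Increasing P f) :
    varA μ f ∈ P :=
  sahi2008b_thm2 hP hμ hf hf

/-! ### Theorem 7 -/

/-- **`Φ(μ,T,f) := Σ_{{ω, T∖ω}} μ(ω)μ(T∖ω)[f(ω) − f(T∖ω)]²`** over unordered pairs of complementary subsets of
`T` — written as one half of the sum over all `ω ⊆ T`. For `T = S` this is the printed `Φ(μ,S,f)`.
[cite: Sahi2008POAlgebras, Thm. 7 (p. 454)] -/
def phi (μ : Finset ι → ℝ) (T : Finset ι) (f : Finset ι → A) : A :=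
  (1 / 2 : ℝ) • ∑ ω ∈ T.powerset, (μ ω * μ (T \ ω)) • ((f ω - f (T \ ω)) * (f ω - f (T \ ω)))

/-- The auxiliary weight `ν(ω) = μ(ω)μ(ωᶜ)/M` of the proof of Theorem 7 (relative to `T`, unnormalised:
`μ(ω)μ(T∖ω)` on `ω ⊆ T`, `0` elsewhere). [cite: Sahi2008POAlgebras, proof of Thm. 7 (p. 455)] -/
def pairWeight (μ : Finset ι → ℝ) (T : Finset ι) (ω : Finset ι) : ℝ :=
  if ω ⊆ T then μ ω * μ (T \ ω) else 0

omit [Fintype ι] in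
/-- `ν ≥ 0`. [cite: Sahi2008POAlgebras, proof of Thm. 7 (p. 455)] -/
theorem pairWeight_nonneg {μ : Finset ι → ℝ} (hμ0 : ∀ α, 0 ≤ μ α) (T ω : Finset ι) :
    0 ≤ pairWeight μ T ω := by
  unfold pairWeight
  split_ifs
  · exact mul_nonneg (hμ0 _) (hμ0 _)
  · exact le_rfl

omit [Fintype ι] in
/-- "An easy calculation shows that `ν` is a probability measure satisfying (1)": the lattice condition for
`ω ↦ μ(ω)μ(T∖ω)` is the product of (1) for `μ` at `(α, β)` and at `(T∖α, T∖β)`.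
[cite: Sahi2008POAlgebras, proof of Thm. 7 (p. 455)] -/
theorem pairWeight_fkg {μ : Finset ι → ℝ} (hμ0 : ∀ α, 0 ≤ μ α)
    (hμ : ∀ a b : Finset ι, μ a * μ b ≤ μ (a ∩ b) * μ (a ∪ b)) (T a b : Finset ι) :
    pairWeight μ T a * pairWeight μ T b ≤ pairWeight μ T (a ∩ b) * pairWeight μ T (a ∪ b) := by
  by_cases ha : a ⊆ T
  · by_cases hb : b ⊆ T
    · have hab : a ∩ b ⊆ T := inter_subset_left.trans ha
      have hab' : a ∪ b ⊆ T := union_subset ha hb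
      simp only [pairWeight, if_pos ha, if_pos hb, if_pos hab, if_pos hab']
      have h1 := hμ a b
      have h2 := hμ (T \ a) (T \ b)
      rw [← sdiff_union_distrib, ← sdiff_inter_distrib_right] at h2
      calc μ a * μ (T \ a) * (μ b * μ (T \ b)) = (μ a * μ b) * (μ (T \ a) * μ (T \ b)) := by ring
        _ ≤ (μ (a ∩ b) * μ (a ∪ b)) * (μ (T \ (a ∪ b)) * μ (T \ (a ∩ b))) :=
          mul_le_mul h1 h2 (mul_nonneg (hμ0 _) (hμ0 _)) (mul_nonneg (hμ0 _) (hμ0 _))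
        _ = μ (a ∩ b) * μ (T \ (a ∩ b)) * (μ (a ∪ b) * μ (T \ (a ∪ b))) := by ring
    · rw [show pairWeight μ T b = 0 by simp [pairWeight, hb], mul_zero]
      exact mul_nonneg (pairWeight_nonneg hμ0 T _) (pairWeight_nonneg hμ0 T _)
  · rw [show pairWeight μ T a = 0 by simp [pairWeight, ha], zero_mul]
    exact mul_nonneg (pairWeight_nonneg hμ0 T _) (pairWeight_nonneg hμ0 T _)

omit [SMulCommClass ℝ A A] [IsScalarTower ℝ A A] [Fintype ι] in
/-- `ω ↦ f(T∖ω)` is decreasing, so `g = f − f∘(T∖·)` is increasing. [cite: Sahi2008POAlgebras, proof of Thm. 7 (p. 455)] -/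
theorem increasing_sub_sdiff (hP : IsPOCone P) {f : Finset ι → A} (hf : Increasing P f) (T : Finset ι) :
    Increasing P fun ω => f ω - f (T \ ω) := by
  intro α β hβα
  have h : f α - f (T \ α) - (f β - f (T \ β)) = (f α - f β) + (f (T \ β) - f (T \ α)) := by abel
  rw [h]
  exact hP.add_mem (hf hβα) (hf (sdiff_subset_sdiff le_rfl hβα))

omit [SMulCommClass ℝ A A] [IsScalarTower ℝ A A] in
/-- `E_ν(g) = 0` for `g = f − f∘ᶜ`: the involution `ω ↦ T ∖ ω` reverses the sign of each term.
[cite: Sahi2008POAlgebras, proof of Thm. 7 (p. 455)] -/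
theorem exA_pairWeight_sub (μ : Finset ι → ℝ) (T : Finset ι) (f : Finset ι → A) :
    exA (pairWeight μ T) (fun ω => f ω - f (T \ ω)) = 0 := by
  unfold exA
  have hsupp : ∑ ω, pairWeight μ T ω • (f ω - f (T \ ω)) =
      ∑ ω ∈ T.powerset, (μ ω * μ (T \ ω)) • (f ω - f (T \ ω)) := by
    rw [← sum_subset (subset_univ T.powerset)]
    · exact sum_congr rfl fun ω hω => by rw [pairWeight, if_pos (mem_powerset.1 hω)]
    · intro ω _ hω
      rw [pairWeight, if_neg (fun h => hω (mem_powerset.2 h)), zero_smul]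
  rw [hsupp]
  -- pair `ω` with `T ∖ ω`
  have hinv := sum_involution (s := T.powerset)
    (f := fun ω => (μ ω * μ (T \ ω)) • (f ω - f (T \ ω))) (fun ω _ => T \ ω)
    (fun ω hω => by
      have hωT : ω ⊆ T := mem_powerset.1 hω
      rw [Finset.sdiff_sdiff_eq_self hωT, mul_comm, ← smul_add, sub_add_sub_cancel, sub_self, smul_zero])
    (fun ω _ hne h => by
      -- `T ∖ ω = ω` makes the term vanish
      apply hne
      rw [h, sub_self, smul_zero])
    (fun ω _ => mem_powerset.2 sdiff_subset)
    (fun ω hω => Finset.sdiff_sdiff_eq_self (mem_powerset.1 hω))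
  exact hinv

/-- **Theorem 7 (Sahi 2008)** for a positive (not necessarily normalised) FKG measure, relative to any
`T ⊆ S`: `Φ(μ,T,f) = Σ_{{ω,T∖ω}} μ(ω)μ(T∖ω)[f(ω) − f(T∖ω)]² ∈ P` for increasing `f : 2^S → A`.  (Printed for
`T = S`; proof as printed: `ν = μ(ω)μ(ωᶜ)/M`, `g = f − f∘ᶜ`, `E_ν(g) = 0`, `E_ν(g²) = (2/M)Φ` and Theorem 4.)
[cite: Sahi2008POAlgebras, Thm. 7 (p. 454) and the remark on positive measures (p. 455)] -/
theorem sahi2008b_thm7 (hP : IsPOCone P) {μ : Finset ι → ℝ} (hμ0 : ∀ α, 0 ≤ μ α)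
    (hμ : ∀ a b : Finset ι, μ a * μ b ≤ μ (a ∩ b) * μ (a ∪ b)) {f : Finset ι → A} (hf : Increasing P f)
    (T : Finset ι) : phi μ T f ∈ P := by
  obtain ⟨M, hM⟩ : ∃ M : ℝ, M = ∑ ω, pairWeight μ T ω := ⟨_, rfl⟩
  have hM0 : 0 ≤ M := hM ▸ sum_nonneg fun ω _ => pairWeight_nonneg hμ0 T ω
  -- the sum of squares against `pairWeight`, without the factor `½`
  obtain ⟨Q, hQ⟩ : ∃ Q : A, Q = ∑ ω, pairWeight μ T ω • ((f ω - f (T \ ω)) * (f ω - f (T \ ω))) :=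
    ⟨_, rfl⟩
  have hphi : phi μ T f = (1 / 2 : ℝ) • Q := by
    rw [phi, hQ, ← sum_subset (subset_univ T.powerset)]
    · congr 1
      exact sum_congr rfl fun ω hω => by rw [pairWeight, if_pos (mem_powerset.1 hω)]
    · intro ω _ hω
      rw [pairWeight, if_neg (fun h => hω (mem_powerset.2 h)), zero_smul]
  rw [hphi]
  refine hP.smul_mem (by norm_num) ?_
  by_cases hMz : M = 0
  · -- `μ(ω)μ(ωᶜ) = 0` for all `ω`: `Φ = 0`
    have hall : ∀ ω, pairWeight μ T ω = 0 := fun ω =>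
      (sum_eq_zero_iff_of_nonneg fun ω _ => pairWeight_nonneg hμ0 T ω).1 (hM ▸ hMz) ω (mem_univ ω)
    have hQ0 : Q = 0 := by rw [hQ]; exact sum_eq_zero fun ω _ => by rw [hall ω, zero_smul]
    rw [hQ0]
    exact hP.zero_mem
  · -- normalise: `ν = pairWeight/M` is an FKG probability weight, `g = f − f∘ᶜ` is increasing with mean `0`
    obtain ⟨ν, hν⟩ : ∃ ν : Finset ι → ℝ, ν = fun ω => M⁻¹ * pairWeight μ T ω := ⟨_, rfl⟩
    have hν0 : ∀ ω, 0 ≤ ν ω := fun ω => by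
      rw [hν]
      exact mul_nonneg (inv_nonneg.2 hM0) (pairWeight_nonneg hμ0 T ω)
    have hν1 : ∑ ω, ν ω = 1 := by
      simp only [hν]
      rw [← mul_sum, ← hM, inv_mul_cancel₀ hMz]
    have hνfkg : ∀ a b : Finset ι, ν a * ν b ≤ ν (a ∩ b) * ν (a ∪ b) := fun a b => by
      have h := pairWeight_fkg hμ0 hμ T a b
      have hi : 0 ≤ M⁻¹ * M⁻¹ := mul_nonneg (inv_nonneg.2 hM0) (inv_nonneg.2 hM0)
      simp only [hν]
      calc M⁻¹ * pairWeight μ T a * (M⁻¹ * pairWeight μ T b)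
          = M⁻¹ * M⁻¹ * (pairWeight μ T a * pairWeight μ T b) := by ring
        _ ≤ M⁻¹ * M⁻¹ * (pairWeight μ T (a ∩ b) * pairWeight μ T (a ∪ b)) :=
          mul_le_mul_of_nonneg_left h hi
        _ = M⁻¹ * pairWeight μ T (a ∩ b) * (M⁻¹ * pairWeight μ T (a ∪ b)) := by ring
    obtain ⟨g, hg⟩ : ∃ g : Finset ι → A, g = fun ω => f ω - f (T \ ω) := ⟨_, rfl⟩
    have hginc : Increasing P g := hg ▸ increasing_sub_sdiff hP hf T
    have hcov := covA_mem_of_increasingOn hP univ ν hν0 hν1 hνfkg (fun α _ => subset_univ α) g g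
      (hginc.increasingOn ν) (hginc.increasingOn ν)
    -- `C_ν(g,g) = E_ν(g²) = M⁻¹ • Q`
    have hEg : exA ν g = 0 := by
      have h := exA_pairWeight_sub μ T f
      unfold exA at h ⊢
      simp only [hν, hg, mul_smul]
      rw [← smul_sum, h, smul_zero]
    have hcov_eq : covA ν g g = M⁻¹ • Q := by
      unfold covA
      rw [hEg]
      simp only [map_zero, sub_zero]
      rw [hQ, smul_sum]
      unfold exA
      refine sum_congr rfl fun ω _ => ?_
      simp only [hν, hg, jordan_self, mul_smul]
    have hQeq : Q = M • covA ν g g := by rw [hcov_eq, smul_smul, mul_inv_cancel₀ hMz, one_smul]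
    rw [hQeq]
    exact hP.smul_mem hM0 hcov

/-- **Theorem 7 as printed** (`T = S`, complements `ωᶜ = S ∖ ω`):
`½ Σ_ω μ(ω)μ(ωᶜ)[f(ω) − f(ωᶜ)]² ∈ P`. [cite: Sahi2008POAlgebras, Thm. 7 (p. 454)] -/
theorem sahi2008b_thm7_univ (hP : IsPOCone P) {μ : Finset ι → ℝ} (hμ0 : ∀ α, 0 ≤ μ α)
    (hμ : ∀ a b : Finset ι, μ a * μ b ≤ μ (a ∩ b) * μ (a ∪ b)) {f : Finset ι → A} (hf : Increasing P f) :
    (1 / 2 : ℝ) • ∑ ω, (μ ω * μ ωᶜ) • ((f ω - f ωᶜ) * (f ω - f ωᶜ)) ∈ P := by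
  have h := sahi2008b_thm7 hP hμ0 hμ hf univ
  rw [phi, powerset_univ] at h
  simpa only [compl_eq_univ_sdiff] using h

end Algebra

/-! ### Theorem 3 (`A` associative and commutative) -/

section CauchySchwarz

variable {A : Type*} [CommRing A] [Module ℝ A] [SMulCommClass ℝ A A] [IsScalarTower ℝ A A]
variable {P : Set A} {ι : Type*} [Fintype ι] [DecidableEq ι]

/-- **Decreasing** `A`-valued function: `g(β) − g(α) ∈ P` for all `β ⊆ α`. [cite: Sahi2008POAlgebras, Thm. 3 (p. 450)] -/
def Decreasing (P : Set A) (g : Finset ι → A) : Prop :=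
  ∀ ⦃α β : Finset ι⦄, β ⊆ α → g β - g α ∈ P

omit [SMulCommClass ℝ A A] [IsScalarTower ℝ A A] [Fintype ι] [DecidableEq ι] in
/-- "If `f₁, f₂` are increasing and `P`-valued functions, then the product `f₁f₂` is also increasing and
`P`-valued": `f₁(α)f₂(α) − f₁(β)f₂(β) = f₁(α)[f₂(α) − f₂(β)] + [f₁(α) − f₁(β)]f₂(β)`.
[cite: Sahi2008POAlgebras, §3 (p. 455, second remark)] -/
theorem increasing_mul (hP : IsPOCone P) {f₁ f₂ : Finset ι → A} (h₁P : ∀ α, f₁ α ∈ P)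
    (h₁ : Increasing P f₁) (h₂P : ∀ α, f₂ α ∈ P) (h₂ : Increasing P f₂) :
    Increasing P fun α => f₁ α * f₂ α := by
  intro α β hβα
  have h : f₁ α * f₂ α - f₁ β * f₂ β = f₁ α * (f₂ α - f₂ β) + (f₁ α - f₁ β) * f₂ β := by ring
  rw [h]
  exact hP.add_mem (hP.mul_mem (h₁P α) (h₂ hβα)) (hP.mul_mem (h₁ hβα) (h₂P β))

omit [DecidableEq ι] in
/-- **The Lagrange identity** (first display of the proof of Theorem 3):
`E(f²)E(g²) − E(fg)² = Σ_{{α,β}} μ(α)μ(β)[f(α)g(β) − g(α)f(β)]²` — here as one half of the sum over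
ordered pairs. [cite: Sahi2008POAlgebras, proof of Thm. 3 (p. 455)] -/
theorem lagrange_identity (μ : Finset ι → ℝ) (f g : Finset ι → A) :
    exA μ (fun α => f α * f α) * exA μ (fun α => g α * g α) -
        exA μ (fun α => f α * g α) * exA μ (fun α => f α * g α) =
      (1 / 2 : ℝ) • ∑ α, ∑ β, (μ α * μ β) • ((f α * g β - g α * f β) * (f α * g β - g α * f β)) := by
  -- `G α β := μ(α)μ(β)[f(α)²g(β)² − f(α)g(α)f(β)g(β)]`, and `G α β + G β α = μ(α)μ(β)[f(α)g(β) − g(α)f(β)]²`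
  have hG : ∀ α β, (μ α * μ β) • ((f α * g β - g α * f β) * (f α * g β - g α * f β)) =
      (μ α * μ β) • (f α * f α * (g β * g β) - f α * g α * (f β * g β)) +
        (μ β * μ α) • (f β * f β * (g α * g α) - f β * g β * (f α * g α)) := fun α β => by
    rw [mul_comm (μ β) (μ α), ← smul_add]
    congr 1
    ring
  have hL : exA μ (fun α => f α * f α) * exA μ (fun α => g α * g α) -
      exA μ (fun α => f α * g α) * exA μ (fun α => f α * g α) =
      ∑ α, ∑ β, (μ α * μ β) • (f α * f α * (g β * g β) - f α * g α * (f β * g β)) := by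
    unfold exA
    rw [Fintype.sum_mul_sum, Fintype.sum_mul_sum, ← sum_sub_distrib]
    refine sum_congr rfl fun α _ => ?_
    rw [← sum_sub_distrib]
    refine sum_congr rfl fun β _ => ?_
    rw [smul_mul_assoc, mul_smul_comm, smul_smul, smul_mul_assoc, mul_smul_comm, smul_smul, ← smul_sub]
  rw [hL]
  simp_rw [hG, sum_add_distrib]
  rw [sum_comm (f := fun α β => (μ β * μ α) • (f β * f β * (g α * g α) - f β * g β * (f α * g α))),
    ← two_smul ℝ, smul_smul]
  norm_num

omit [Fintype ι] in
/-- `(α ∩ β) ∪ (α ∖ β) = α`. [folklore] -/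
private theorem inter_union_sdiff_eq (α β : Finset ι) : α ∩ β ∪ α \ β = α := by
  ext y; simp only [mem_union, mem_inter, mem_sdiff]; tauto

omit [Fintype ι] in
/-- `(α ∩ β) ∪ (((α ∪ β) ∖ (α ∩ β)) ∖ (α ∖ β)) = β`. [folklore] -/
private theorem inter_union_sdiff_sdiff_eq (α β : Finset ι) :
    α ∩ β ∪ (((α ∪ β) \ (α ∩ β)) \ (α \ β)) = β := by
  ext y; simp only [mem_union, mem_inter, mem_sdiff]; tauto

/-- **"Grouping together all the terms with a fixed union and intersection"**: the ordered pairs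
`(α, β)` correspond to the triples `(ω₀, ω₁, γ)`, `ω₀ = α ∩ β ⊆ ω₁ = α ∪ β`, `γ = α ∖ β ⊆ T = ω₁ ∖ ω₀`,
via `α = γ ∪ ω₀`, `β = γᶜ ∪ ω₀` (complement in `T`). [cite: Sahi2008POAlgebras, proof of Thm. 3 (pp. 455–456)] -/
theorem sum_pairs_eq_sum_unionInter {M : Type*} [AddCommMonoid M] (W : Finset ι → Finset ι → M) :
    ∑ α, ∑ β, W α β = ∑ ω₀ : Finset ι, ∑ ω₁ ∈ univ.filter (fun ω₁ : Finset ι => ω₀ ⊆ ω₁),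
      ∑ γ ∈ (ω₁ \ ω₀).powerset, W (ω₀ ∪ γ) (ω₀ ∪ ((ω₁ \ ω₀) \ γ)) := by
  -- the target as one sum over a filtered triple product
  have hR : (∑ ω₀ : Finset ι, ∑ ω₁ ∈ univ.filter (fun ω₁ : Finset ι => ω₀ ⊆ ω₁),
      ∑ γ ∈ (ω₁ \ ω₀).powerset, W (ω₀ ∪ γ) (ω₀ ∪ ((ω₁ \ ω₀) \ γ))) =
      ∑ q ∈ (univ : Finset (Finset ι × Finset ι × Finset ι)).filter
          (fun q => q.1 ⊆ q.2.1 ∧ q.2.2 ⊆ q.2.1 \ q.1),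
        W (q.1 ∪ q.2.2) (q.1 ∪ ((q.2.1 \ q.1) \ q.2.2)) := by
    rw [sum_filter, Fintype.sum_prod_type]
    refine sum_congr rfl fun ω₀ _ => ?_
    rw [Fintype.sum_prod_type, sum_filter]
    refine sum_congr rfl fun ω₁ _ => ?_
    split_ifs with h01
    · rw [← filter_subset_univ, sum_filter]
      refine sum_congr rfl fun γ _ => ?_
      simp only [h01, true_and]
    · symm
      exact sum_eq_zero fun γ _ => if_neg fun h => h01 h.1
  rw [hR, ← Fintype.sum_prod_type' W, ← univ_product_univ]
  refine sum_nbij' (fun p => (p.1 ∩ p.2, p.1 ∪ p.2, p.1 \ p.2))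
    (fun q => (q.1 ∪ q.2.2, q.1 ∪ ((q.2.1 \ q.1) \ q.2.2))) ?_ ?_ ?_ ?_ ?_
  · -- into the triples
    rintro ⟨α, β⟩ -
    refine mem_filter.2 ⟨mem_univ _, inter_subset_left.trans subset_union_left, ?_⟩
    intro y
    simp only [mem_sdiff, mem_union, mem_inter]
    tauto
  · rintro q -
    simp
  · rintro ⟨α, β⟩ -
    simp only [inter_union_sdiff_eq, inter_union_sdiff_sdiff_eq]
  · rintro ⟨ω₀, ω₁, γ⟩ hq
    obtain ⟨h01, hγ⟩ := (mem_filter.1 hq).2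
    simp only at h01 hγ
    have e : ∀ y, (y ∈ ω₀ → y ∈ ω₁) ∧ (y ∈ γ → y ∈ ω₁ ∧ y ∉ ω₀) := fun y =>
      ⟨fun h => h01 h, fun h => by simpa [mem_sdiff] using hγ h⟩
    refine Prod.ext ?_ (Prod.ext ?_ ?_) <;> ext y <;> have ey := e y <;>
      simp only [mem_inter, mem_union, mem_sdiff] <;> tauto
  · rintro ⟨α, β⟩ -
    simp only [inter_union_sdiff_eq, inter_union_sdiff_sdiff_eq]

/-- **Theorem 3 (Sahi 2008), Cauchy–Schwarz form.**  Let `(A,P)` be a partially ordered algebra with `A`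
associative and commutative, `μ ≥ 0` a measure on `2^S` satisfying (1), `f : 2^S → P` increasing and
`g : 2^S → P` decreasing.  Then `E_μ(f²)E_μ(g²) − E_μ(fg)²` is positive.  (Printed for probability measures;
the statement is homogeneous in `μ`.  Here `A` is also assumed unital — TODO(general form): non-unital
commutative `A`.)  Proof as printed: Lagrange identity, grouping by `(α ∩ β, α ∪ β)`, and Theorem 7 on
`2^T`, `T = ω₁ ∖ ω₀`, for `ν(γ) = μ(γ ∪ ω₀)`, `h(γ) = f(γ ∪ ω₀) g(γᶜ ∪ ω₀)`.
[cite: Sahi2008POAlgebras, Thm. 3 (p. 450) and its proof (pp. 455–456)] -/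
theorem sahi2008b_thm3 (hP : IsPOCone P) {μ : Finset ι → ℝ} (hμ0 : ∀ α, 0 ≤ μ α)
    (hμ : ∀ a b : Finset ι, μ a * μ b ≤ μ (a ∩ b) * μ (a ∪ b)) {f g : Finset ι → A}
    (hfP : ∀ α, f α ∈ P) (hf : Increasing P f) (hgP : ∀ α, g α ∈ P) (hg : Decreasing P g) :
    exA μ (fun α => f α * f α) * exA μ (fun α => g α * g α) -
        exA μ (fun α => f α * g α) * exA μ (fun α => f α * g α) ∈ P := by
  rw [lagrange_identity μ f g,
    sum_pairs_eq_sum_unionInter (fun α β => (μ α * μ β) • ((f α * g β - g α * f β) * (f α * g β - g α * f β))),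
    smul_sum]
  refine hP.sum_mem fun ω₀ _ => ?_
  rw [smul_sum]
  refine hP.sum_mem fun ω₁ hω₁ => ?_
  -- the inner sum over `γ ⊆ T = ω₁ ∖ ω₀` is `Φ(ν, T, h)`
  set T := ω₁ \ ω₀ with hT
  have hphi : (1 / 2 : ℝ) • ∑ γ ∈ T.powerset,
      (μ (ω₀ ∪ γ) * μ (ω₀ ∪ (T \ γ))) •
        ((f (ω₀ ∪ γ) * g (ω₀ ∪ (T \ γ)) - g (ω₀ ∪ γ) * f (ω₀ ∪ (T \ γ))) *
          (f (ω₀ ∪ γ) * g (ω₀ ∪ (T \ γ)) - g (ω₀ ∪ γ) * f (ω₀ ∪ (T \ γ)))) =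
      phi (fun γ => μ (ω₀ ∪ γ)) T (fun γ => f (ω₀ ∪ γ) * g (ω₀ ∪ (T \ γ))) := by
    unfold phi
    congr 1
    refine sum_congr rfl fun γ hγ => ?_
    have hγT : γ ⊆ T := mem_powerset.1 hγ
    simp only [Finset.sdiff_sdiff_eq_self hγT, mul_comm (g (ω₀ ∪ γ)) (f (ω₀ ∪ (T \ γ)))]
  rw [hphi]
  -- `ν = μ(ω₀ ∪ ·)` is a positive FKG measure and `h` is increasing (product of increasing `P`-valued functions)
  refine sahi2008b_thm7 hP (fun γ => hμ0 _) (fun a b => ?_) ?_ T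
  · have h := hμ (ω₀ ∪ a) (ω₀ ∪ b)
    rwa [← union_inter_distrib_left, ← union_union_distrib_left] at h
  · refine increasing_mul hP (fun γ => hfP _) (fun γ δ hδγ => hf (union_subset_union le_rfl hδγ))
      (fun γ => hgP _) fun γ δ hδγ => hg (union_subset_union le_rfl (sdiff_subset_sdiff le_rfl hδγ))

/-- **Theorem 3 as printed** (probability FKG weight `μ` on `2^S`). [cite: Sahi2008POAlgebras, Thm. 3 (p. 450)] -/
theorem sahi2008b_thm3' (hP : IsPOCone P) {μ : Finset ι → ℝ}
    (hμ : Literature.Combinatorics.Sahi2008.IsFKGMeasure μ) {f g : Finset ι → A}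
    (hfP : ∀ α, f α ∈ P) (hf : Increasing P f) (hgP : ∀ α, g α ∈ P) (hg : Decreasing P g) :
    exA μ (fun α => f α * f α) * exA μ (fun α => g α * g α) -
        exA μ (fun α => f α * g α) * exA μ (fun α => f α * g α) ∈ P :=
  sahi2008b_thm3 hP hμ.nonneg hμ.mul_le_mul hfP hf hgP hg

end CauchySchwarz

/-! ### The examples of p. 451, and `A = ℝ` -/

/-- `A = ℝ` with `P = [0, ∞)` is a partially ordered algebra. [cite: Sahi2008POAlgebras, §1 (p. 449)] -/
theorem isPOCone_real : IsPOCone (Set.Ici (0 : ℝ)) where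
  zero_mem := Set.mem_Ici.2 le_rfl
  add_mem hu hv := Set.mem_Ici.2 (add_nonneg (Set.mem_Ici.1 hu) (Set.mem_Ici.1 hv))
  smul_mem hc hu := Set.mem_Ici.2 (by rw [smul_eq_mul]; exact mul_nonneg hc (Set.mem_Ici.1 hu))
  mul_mem hu hv := Set.mem_Ici.2 (mul_nonneg (Set.mem_Ici.1 hu) (Set.mem_Ici.1 hv))

/-- **Example 2 (p. 451)**: `A = ℝ[x]`, `P` = the polynomials with positive (`≥ 0`) coefficients, is a
partially ordered algebra. [cite: Sahi2008POAlgebras, §1 example 2 (p. 451)] -/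
theorem isPOCone_polynomial : IsPOCone {p : Polynomial ℝ | ∀ n, 0 ≤ p.coeff n} where
  zero_mem := fun n => by simp
  add_mem hu hv := fun n => by rw [Polynomial.coeff_add]; exact add_nonneg (hu n) (hv n)
  smul_mem hc hu := fun n => by rw [Polynomial.coeff_smul, smul_eq_mul]; exact mul_nonneg hc (hu n)
  mul_mem hu hv := fun n => by
    rw [Polynomial.coeff_mul]
    exact Finset.sum_nonneg fun ij _ => mul_nonneg (hu _) (hv _)

/-- **Example 1 (p. 451)** in its simplest instance: `A` = real `n × n` matrices, `P` = the entrywise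
nonnegative matrices (the matrices preserving the convex cone `[0,∞)^n ⊆ ℝ^n`), is a partially ordered algebra.
[cite: Sahi2008POAlgebras, §1 example 1 (p. 451)] -/
theorem isPOCone_matrix (n : Type*) [Fintype n] [DecidableEq n] :
    IsPOCone {M : Matrix n n ℝ | ∀ i j, 0 ≤ M i j} where
  zero_mem := fun i j => by simp
  add_mem hu hv := fun i j => by rw [Matrix.add_apply]; exact add_nonneg (hu i j) (hv i j)
  smul_mem hc hu := fun i j => by rw [Matrix.smul_apply, smul_eq_mul]; exact mul_nonneg hc (hu i j)
  mul_mem hu hv := fun i j => by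
    rw [Matrix.mul_apply]
    exact Finset.sum_nonneg fun k _ => mul_nonneg (hu i k) (hv k j)

/-- **For `A = ℝ` Theorem 2 is the classical FKG inequality on `2^S`**:
`Σ_α μ(α) f(α)g(α) ≥ (Σ_α μ(α)f(α))(Σ_α μ(α)g(α))` for increasing real `f, g` and an FKG probability weight.
[cite: Sahi2008POAlgebras, §1 (p. 449: "The FKG inequality asserts … `C_μ(f,g) ≥ 0`") ] -/
theorem fkg_real_of_thm2 {ι : Type*} [Fintype ι] [DecidableEq ι] {μ : Finset ι → ℝ}
    (hμ : Literature.Combinatorics.Sahi2008.IsFKGMeasure μ) {f g : Finset ι → ℝ} (hf : Monotone f)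
    (hg : Monotone g) : (∑ α, μ α * f α) * (∑ α, μ α * g α) ≤ ∑ α, μ α * (f α * g α) := by
  have hf' : Increasing (Set.Ici (0 : ℝ)) f := fun α β h => Set.mem_Ici.2 (sub_nonneg.2 (hf h))
  have hg' : Increasing (Set.Ici (0 : ℝ)) g := fun α β h => Set.mem_Ici.2 (sub_nonneg.2 (hg h))
  have h := sahi2008b_thm2 isPOCone_real hμ hf' hg'
  rw [Set.mem_Ici, covA, exA, exA, exA] at h
  simp only [jordan_apply, smul_eq_mul] at h
  have e1 : ∀ u v : ℝ, (1 / 2 : ℝ) * (u * v + v * u) = u * v := fun u v => by ring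
  simp only [e1] at h
  linarith

/-! ### Marginals, conditional expectations, and the den Hollander–Keane monotonicity

Richards [Richards2004, (2.2)–(2.4)], following den Hollander–Keane (1986): for `B ⊆ A` the marginal
`μ_B(a) := Σ_{b ⊆ A∖B} μ(a ∪ b)` (`a ⊆ B`), the conditional expectation
`f_B(a) := μ_B(a)⁻¹ Σ_{b ⊆ A∖B} μ(a ∪ b) f(a ∪ b)`, `E_B(g) := Σ_{a ⊆ B} μ_B(a) g(a)` and the double expectation
theorem `E(f) = E_B(f_B)`.  We index by the set `C = A ∖ B` of coordinates that are integrated out, so that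
`μ_{A∖(C ∪ {x})} = (μ_{A∖C})_x` is Sahi's collapse iterated (`marg_insert`, `cexp_insert`), and everything is
stated for `A`-valued `f` as in the rest of this file.  Den Hollander–Keane's sharpening of FKG
[DenhollanderKeane1986, Thm. 4(b)], as reported in [Richards2004, Rem. 2.3 (p. 1518)]: "(2.15)
`E(f₁f₂) − E_B(f_{1B} f_{2B})` is a decreasing function of `B ∈ 2^A`" — here `exA_marg_cexp_mono`, in the
partially ordered algebra generality of Sahi's Theorem 2 (its one-step case is exactly `covA_eq_collapse_add` +
`stepTerm_mem`). -/

section Marginal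

variable {A : Type*} [NonUnitalNonAssocRing A] [Module ℝ A] [SMulCommClass ℝ A A] [IsScalarTower ℝ A A]
variable {P : Set A} {ι : Type*} [Fintype ι] [DecidableEq ι]

/-- **Marginal** `μ_B(a) := Σ_{b ⊆ A∖B} μ(a ∪ b)` for `a ⊆ B` ("`μ_B` is the marginal probability measure on the
lattice `2^B`"), indexed by `C = A ∖ B` and extended by `0` to the `a` meeting `C`, as a weight on `2^A`.
[cite: Richards2004, (2.2) (p. 1514–1515)] -/
def marg (μ : Finset ι → ℝ) (C : Finset ι) (a : Finset ι) : ℝ :=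
  if Disjoint a C then ∑ b ∈ C.powerset, μ (a ∪ b) else 0

/-- **Conditional expectation** `f_B(a) := μ_B(a)⁻¹ Σ_{b ⊆ A∖B} μ(a ∪ b) f(a ∪ b)` of `f` given `a ⊆ B = A ∖ C`
("`f_B(a)` is the conditional expectation of `f`, given `a ⊆ B`"), set to `0` where `μ_B(a) = 0`.
[cite: Richards2004, (2.3) (p. 1514–1515)] -/
def cexp (μ : Finset ι → ℝ) (f : Finset ι → A) (C : Finset ι) (a : Finset ι) : A :=
  if marg μ C a = 0 then 0 else (marg μ C a)⁻¹ • ∑ b ∈ C.powerset, μ (a ∪ b) • f (a ∪ b)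

omit [Fintype ι] in
/-- `μ_B(a) = Σ_{b ⊆ A∖B} μ(a ∪ b)` for `a ⊆ B` (`a` disjoint from `C = A ∖ B`).
[cite: Richards2004, (2.2) (p. 1514)] -/
theorem marg_of_disjoint {μ : Finset ι → ℝ} {C a : Finset ι} (h : Disjoint a C) :
    marg μ C a = ∑ b ∈ C.powerset, μ (a ∪ b) :=
  if_pos h

omit [Fintype ι] in
/-- `μ_B` (as a weight on `2^A`) vanishes off `2^B`. [cite: Richards2004, (2.2) (p. 1514)] -/
theorem marg_of_not_disjoint {μ : Finset ι → ℝ} {C a : Finset ι} (h : ¬Disjoint a C) : marg μ C a = 0 :=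
  if_neg h

omit [Fintype ι] in
/-- `μ_B ≥ 0` for `μ ≥ 0`. [cite: Richards2004, (2.2) (p. 1514)] -/
theorem marg_nonneg {μ : Finset ι → ℝ} (hμ0 : ∀ α, 0 ≤ μ α) (C a : Finset ι) : 0 ≤ marg μ C a := by
  unfold marg
  split_ifs
  · exact sum_nonneg fun b _ => hμ0 _
  · exact le_rfl

omit [Fintype ι] in
/-- `μ_A = μ` (nothing integrated out). [cite: Richards2004, (2.2) (p. 1514)] -/
@[simp] theorem marg_empty (μ : Finset ι → ℝ) : marg μ ∅ = μ := by
  funext a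
  simp [marg]

omit [SMulCommClass ℝ A A] [IsScalarTower ℝ A A] [Fintype ι] in
/-- `μ_B(a) f_B(a) = Σ_{b ⊆ A∖B} μ(a ∪ b) f(a ∪ b)` for `a ⊆ B` (also when `μ_B(a) = 0`, for `μ ≥ 0`).
[cite: Richards2004, (2.3) (p. 1514)] -/
theorem marg_smul_cexp {μ : Finset ι → ℝ} (hμ0 : ∀ α, 0 ≤ μ α) (f : Finset ι → A) {C a : Finset ι}
    (h : Disjoint a C) : marg μ C a • cexp μ f C a = ∑ b ∈ C.powerset, μ (a ∪ b) • f (a ∪ b) := by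
  unfold cexp
  split_ifs with h0
  · rw [smul_zero]
    symm
    refine sum_eq_zero fun b hb => ?_
    have hb0 : μ (a ∪ b) = 0 :=
      (sum_eq_zero_iff_of_nonneg fun b _ => hμ0 (a ∪ b)).1 (by rwa [marg_of_disjoint h] at h0) b hb
    rw [hb0, zero_smul]
  · rw [smul_smul, mul_inv_cancel₀ h0, one_smul]

omit [SMulCommClass ℝ A A] [IsScalarTower ℝ A A] [Fintype ι] in
/-- `f_A = f` on `supp(μ)`. [cite: Richards2004, (2.3) (p. 1514)] -/
theorem cexp_empty_of_ne {μ : Finset ι → ℝ} (f : Finset ι → A) {a : Finset ι} (h : μ a ≠ 0) :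
    cexp μ f ∅ a = f a := by
  have hm : marg μ ∅ a = μ a := by rw [marg_empty]
  unfold cexp
  rw [hm, if_neg h, powerset_empty, sum_singleton, union_empty, smul_smul, inv_mul_cancel₀ h, one_smul]

omit [Fintype ι] in
/-- **Tower property of marginals**: `μ_{A∖(C∪x)} = (μ_{A∖C})_x` — integrating out one more coordinate is Sahi's
collapse ("it suffices … to assume that `B = A ∖ {z}` …; this amounts to a proof by induction on the length of
maximal chains"). [cite: Richards2004, (2.2) and p. 1515] -/
theorem marg_insert (μ : Finset ι → ℝ) {x : ι} {C : Finset ι} (hx : x ∉ C) :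
    marg μ (insert x C) = collapse (marg μ C) x := by
  funext a
  by_cases hxa : x ∈ a
  · rw [collapse_of_mem hxa, marg_of_not_disjoint fun h => (disjoint_insert_right.1 h).1 hxa]
  rw [collapse_of_not_mem hxa]
  by_cases hd : Disjoint a C
  · rw [marg_of_disjoint (disjoint_insert_right.2 ⟨hxa, hd⟩), marg_of_disjoint hd,
      marg_of_disjoint (disjoint_insert_left.2 ⟨hx, hd⟩), sum_powerset_insert hx]
    congr 1
    exact sum_congr rfl fun b _ => by rw [union_insert, insert_union]
  · rw [marg_of_not_disjoint fun h => hd (disjoint_insert_right.1 h).2, marg_of_not_disjoint hd,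
      marg_of_not_disjoint fun h => hd (disjoint_insert_left.1 h).2, add_zero]

omit [SMulCommClass ℝ A A] [IsScalarTower ℝ A A] [Fintype ι] in
/-- **Tower property of conditional expectations**: `f_{A∖(C∪x)} = (f_{A∖C})_x` (for `μ ≥ 0`).
[cite: Richards2004, (2.3) and p. 1515] -/
theorem cexp_insert {μ : Finset ι → ℝ} (hμ0 : ∀ α, 0 ≤ μ α) (f : Finset ι → A) {x : ι} {C : Finset ι}
    (hx : x ∉ C) : cexp μ f (insert x C) = collapseFun (marg μ C) (cexp μ f C) x := by
  funext a
  have hm : collapse (marg μ C) x a = marg μ (insert x C) a := by rw [marg_insert μ hx]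
  unfold collapseFun
  rw [hm]
  by_cases h0 : marg μ (insert x C) a = 0
  · rw [cexp, if_pos h0, if_pos h0]
  rw [if_neg h0, cexp, if_neg h0]
  congr 1
  have h1 : Disjoint a (insert x C) := by
    by_contra h
    exact h0 (marg_of_not_disjoint h)
  obtain ⟨_, hd⟩ := disjoint_insert_right.1 h1
  rw [marg_smul_cexp hμ0 f hd, marg_smul_cexp hμ0 f (disjoint_insert_left.2 ⟨hx, hd⟩), sum_powerset_insert hx]
  congr 1
  exact sum_congr rfl fun b _ => by rw [union_insert, insert_union]

/-- `μ_B` has the total mass of `μ`. [cite: Richards2004, (2.2)–(2.4) (p. 1514–1515)] -/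
theorem sum_marg (μ : Finset ι → ℝ) (C : Finset ι) : ∑ a, marg μ C a = ∑ α, μ α := by
  induction C using Finset.induction_on with
  | empty => rw [marg_empty]
  | insert x C hx ih => rw [marg_insert μ hx, sum_collapse, ih]

omit [Fintype ι] in
/-- **`μ_B` is MTP₂** when `μ ≥ 0` is ("It can be shown [cf. den Hollander and Keane (1986), page 171] that `μ_B`
is MTP₂"); by iterating Lemma 5. [cite: Richards2004, p. 1515; Sahi2008POAlgebras, Lemma 5 (p. 452)] -/
theorem marg_fkg {μ : Finset ι → ℝ} (hμ0 : ∀ α, 0 ≤ μ α)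
    (hμ : ∀ a b : Finset ι, μ a * μ b ≤ μ (a ∩ b) * μ (a ∪ b)) (C : Finset ι) :
    ∀ a b : Finset ι, marg μ C a * marg μ C b ≤ marg μ C (a ∩ b) * marg μ C (a ∪ b) := by
  induction C using Finset.induction_on with
  | empty => simpa only [marg_empty] using hμ
  | insert x C hx ih =>
    rw [marg_insert μ hx]
    exact collapse_fkg (fun a => marg_nonneg hμ0 C a) ih x

omit [SMulCommClass ℝ A A] [IsScalarTower ℝ A A] [Fintype ι] in
/-- **`f_B` is increasing** (on `supp(μ_B)`) **if `f` is increasing** (on `supp(μ)`), for `μ ≥ 0` MTP₂ ("and that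
`f_B` is increasing if `f` is increasing"); by iterating Lemma 6.
[cite: Richards2004, p. 1515; Sahi2008POAlgebras, Lemma 6 (p. 453)] -/
theorem increasingOn_cexp (hP : IsPOCone P) {μ : Finset ι → ℝ} (hμ0 : ∀ α, 0 ≤ μ α)
    (hμ : ∀ a b : Finset ι, μ a * μ b ≤ μ (a ∩ b) * μ (a ∪ b)) {f : Finset ι → A}
    (hf : IncreasingOn P μ f) (C : Finset ι) : IncreasingOn P (marg μ C) (cexp μ f C) := by
  induction C using Finset.induction_on with
  | empty =>
    intro α β hα hβ hβα
    rw [marg_empty] at hα hβ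
    rw [cexp_empty_of_ne f hα, cexp_empty_of_ne f hβ]
    exact hf hα hβ hβα
  | insert x C hx ih =>
    rw [marg_insert μ hx, cexp_insert hμ0 f hx]
    exact increasingOn_collapseFun hP (fun a => marg_nonneg hμ0 C a) (marg_fkg hμ0 hμ C) ih x

omit [SMulCommClass ℝ A A] [IsScalarTower ℝ A A] in
/-- **Double expectation theorem** `E(f) = E_B(f_B)` (2.4) ("the expected value of `f` equals the expected value
of its conditional expectations"), for `μ ≥ 0`. [cite: Richards2004, (2.4) (p. 1515)] -/
theorem exA_marg_cexp {μ : Finset ι → ℝ} (hμ0 : ∀ α, 0 ≤ μ α) (f : Finset ι → A) (C : Finset ι) :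
    exA (marg μ C) (cexp μ f C) = exA μ f := by
  induction C using Finset.induction_on with
  | empty =>
    unfold exA
    rw [marg_empty]
    refine sum_congr rfl fun α _ => ?_
    by_cases h : μ α = 0
    · rw [h, zero_smul, zero_smul]
    · rw [cexp_empty_of_ne f h]
  | insert x C hx ih =>
    rw [marg_insert μ hx, cexp_insert hμ0 f hx, exA_collapse (fun a => marg_nonneg hμ0 C a), ih]

/-- **`E_B(f_B · g_B) = E_{B∖x}(f_{B∖x} · g_{B∖x}) + Σ_β` (step terms of `μ_B`)**: one step of den Hollander–Keane's
monotonicity is Sahi's identity `exA_jordan_eq_collapse_add` for the marginal `μ_B`.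
[cite: Richards2004, Rem. 2.3 (p. 1518); Sahi2008POAlgebras, proof of Thm. 4 (p. 454)] -/
theorem exA_marg_cexp_insert {μ : Finset ι → ℝ} (hμ0 : ∀ α, 0 ≤ μ α) (f g : Finset ι → A) {x : ι}
    {C : Finset ι} (hx : x ∉ C) :
    exA (marg μ C) (fun a => jordan (cexp μ f C a) (cexp μ g C a)) =
      exA (marg μ (insert x C)) (fun a => jordan (cexp μ f (insert x C) a) (cexp μ g (insert x C) a)) +
        ∑ β, stepTerm (marg μ C) (cexp μ f C) (cexp μ g C) x β := by
  rw [marg_insert μ hx, cexp_insert hμ0 f hx, cexp_insert hμ0 g hx]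
  exact exA_jordan_eq_collapse_add (fun a => marg_nonneg hμ0 C a) _ _ x

/-- **den Hollander–Keane, Theorem 4(b) (monotonicity of the FKG defect), for partially ordered algebras.**
For `μ ≥ 0` on `2^A` satisfying the lattice condition and `f, g` increasing on `supp(μ)` with values in a
partially ordered algebra `(A, P)`: `B ↦ E_B(f_B · g_B)` is increasing in `B`, i.e. for `C ⊆ C'`,
`E_{A∖C}(f · g) − E_{A∖C'}(f · g) ∈ P`; equivalently "(2.15) `E(f₁f₂) − E_B(f_{1B} f_{2B})` is a decreasing
function of `B ∈ 2^A`" [den Hollander–Keane (1986), Thm. 4(b), real-valued case, as reported by Richards].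
The extreme cases `C = ∅`, `C' = A` give back Theorem 2 (`covA_eq_exA_marg_sub`).
[cite: DenhollanderKeane1986, Thm. 4(b) (as reported in Richards2004, Rem. 2.3, p. 1518)] -/
theorem exA_marg_cexp_mono (hP : IsPOCone P) {μ : Finset ι → ℝ} (hμ0 : ∀ α, 0 ≤ μ α)
    (hμ : ∀ a b : Finset ι, μ a * μ b ≤ μ (a ∩ b) * μ (a ∪ b)) {f g : Finset ι → A}
    (hf : IncreasingOn P μ f) (hg : IncreasingOn P μ g) {C C' : Finset ι} (hCC' : C ⊆ C') :
    exA (marg μ C) (fun a => jordan (cexp μ f C a) (cexp μ g C a)) -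
      exA (marg μ C') (fun a => jordan (cexp μ f C' a) (cexp μ g C' a)) ∈ P := by
  -- induction on `D = C' ∖ C`, one coordinate at a time
  suffices h : ∀ D : Finset ι, exA (marg μ C) (fun a => jordan (cexp μ f C a) (cexp μ g C a)) -
      exA (marg μ (C ∪ D)) (fun a => jordan (cexp μ f (C ∪ D) a) (cexp μ g (C ∪ D) a)) ∈ P by
    have := h (C' \ C)
    rwa [union_sdiff_of_subset hCC'] at this
  intro D
  induction D using Finset.induction_on with
  | empty =>
    rw [union_empty, sub_self]
    exact hP.zero_mem
  | insert x D hxD ih =>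
    by_cases hx : x ∈ C ∪ D
    · rwa [union_insert, insert_eq_of_mem hx]
    refine hP.sub_mem_trans ih ?_
    rw [union_insert, exA_marg_cexp_insert hμ0 f g hx, add_sub_cancel_left]
    exact hP.sum_mem fun β _ => stepTerm_mem hP (fun a => marg_nonneg hμ0 _ a)
      (increasingOn_cexp hP hμ0 hμ hf _) (increasingOn_cexp hP hμ0 hμ hg _) x β

/-- At `B = ∅` (`C = A`): `μ_∅ = (Σμ) δ_∅` and `E_∅(f_∅ · g_∅) = E(f) · E(g)` for a probability weight `μ ≥ 0`;
at `B = A`: `E_A(f_A · g_A) = E(f · g)`.  Hence `C_μ(f,g) = E_A(f_A·g_A) − E_∅(f_∅·g_∅)`, the value of (2.15) at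
`B = ∅`. [cite: Richards2004, Rem. 2.3 (p. 1518)] -/
theorem covA_eq_exA_marg_sub {μ : Finset ι → ℝ} (hμ0 : ∀ α, 0 ≤ μ α) (hμ1 : ∑ α, μ α = 1)
    (f g : Finset ι → A) :
    covA μ f g = exA (marg μ ∅) (fun a => jordan (cexp μ f ∅ a) (cexp μ g ∅ a)) -
      exA (marg μ univ) (fun a => jordan (cexp μ f univ a) (cexp μ g univ a)) := by
  unfold covA
  congr 1
  · unfold exA
    rw [marg_empty]
    refine sum_congr rfl fun α _ => ?_
    dsimp only
    by_cases h : μ α = 0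
    · rw [h, zero_smul, zero_smul]
    · rw [cexp_empty_of_ne f h, cexp_empty_of_ne g h]
  · -- `μ_∅ = δ_∅` (as `Σ μ = 1`) and `f_∅(∅) = E(f)`
    have hm : ∀ a : Finset ι, marg μ univ a = if a = ∅ then 1 else 0 := fun a => by
      by_cases ha : a = ∅
      · rw [if_pos ha, marg_of_disjoint (by rw [ha]; exact disjoint_empty_left _), ← hμ1, powerset_univ]
        exact sum_congr rfl fun b _ => by rw [ha, empty_union]
      · rw [if_neg ha, marg_of_not_disjoint]
        rwa [← top_eq_univ, disjoint_top, bot_eq_empty]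
    have hc : ∀ h : Finset ι → A, cexp μ h univ ∅ = exA μ h := fun h => by
      have h1 : marg μ univ ∅ = 1 := by rw [hm, if_pos rfl]
      have := marg_smul_cexp hμ0 h (disjoint_empty_left (univ : Finset ι))
      rw [h1, one_smul, powerset_univ] at this
      rw [this]
      exact sum_congr rfl fun b _ => by rw [empty_union]
    symm
    calc exA (marg μ univ) (fun a => jordan (cexp μ f univ a) (cexp μ g univ a))
        = marg μ univ ∅ • jordan (cexp μ f univ ∅) (cexp μ g univ ∅) :=
          Finset.sum_eq_single ∅ (fun a _ ha => by rw [hm, if_neg ha, zero_smul])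
            (fun h => absurd (mem_univ _) h)
      _ = jordan (exA μ f) (exA μ g) := by rw [hm, if_pos rfl, one_smul, hc, hc]

/-- **den Hollander–Keane, Theorem 4(b), the printed real-valued case** (`A = ℝ`, `P = [0,∞)`): for an MTP₂
weight `μ ≥ 0` on `2^A` and increasing `f, g : 2^A → ℝ`, `B ↦ E_B(f_B g_B)` is increasing — for `C ⊆ C'`,
`E_{A∖C'}(f_{A∖C'} g_{A∖C'}) ≤ E_{A∖C}(f_{A∖C} g_{A∖C})`; i.e. "(2.15) `E(f₁f₂) − E_B(f_{1B}f_{2B})` is a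
decreasing function of `B ∈ 2^A`", from `Cov_μ(f,g)` at `B = ∅` down to `0` at `B = A`.
[cite: DenhollanderKeane1986, Thm. 4(b) (as reported in Richards2004, Rem. 2.3, p. 1518)] -/
theorem denHollanderKeane_thm4b {μ : Finset ι → ℝ} (hμ0 : ∀ α, 0 ≤ μ α)
    (hμ : ∀ a b : Finset ι, μ a * μ b ≤ μ (a ∩ b) * μ (a ∪ b)) {f g : Finset ι → ℝ} (hf : Monotone f)
    (hg : Monotone g) {C C' : Finset ι} (hCC' : C ⊆ C') :
    ∑ a, marg μ C' a * (cexp μ f C' a * cexp μ g C' a) ≤ ∑ a, marg μ C a * (cexp μ f C a * cexp μ g C a) := by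
  have hf' : Increasing (Set.Ici (0 : ℝ)) f := fun α β h => Set.mem_Ici.2 (sub_nonneg.2 (hf h))
  have hg' : Increasing (Set.Ici (0 : ℝ)) g := fun α β h => Set.mem_Ici.2 (sub_nonneg.2 (hg h))
  have h := exA_marg_cexp_mono isPOCone_real hμ0 hμ (hf'.increasingOn μ) (hg'.increasingOn μ) hCC'
  rw [Set.mem_Ici, exA, exA] at h
  simp only [jordan_apply, smul_eq_mul] at h
  have e1 : ∀ u v : ℝ, (1 / 2 : ℝ) * (u * v + v * u) = u * v := fun u v => by ring
  simp only [e1] at h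
  linarith

end Marginal

/-! ### §4: the Ahlswede–Daykin four functions theorem fails over a partially ordered algebra -/

section AhlswedeDaykin

open Polynomial

/-- The cone of Example 2 (p. 451): real polynomials with nonnegative coefficients.
[cite: Sahi2008POAlgebras, §1 example 2 (p. 451) and §4 (p. 456)] -/
def polyCone : Set (Polynomial ℝ) := {p | ∀ n, 0 ≤ p.coeff n}

/-- `x^k` has nonnegative coefficients. [cite: Sahi2008POAlgebras, §4 (p. 457)] -/
private theorem X_pow_mem_polyCone (k : ℕ) : (X ^ k : Polynomial ℝ) ∈ polyCone := fun n => by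
  rw [coeff_X_pow]; split_ifs <;> norm_num

/-- `x` has nonnegative coefficients. [cite: Sahi2008POAlgebras, §4 (p. 457)] -/
private theorem X_mem_polyCone : (X : Polynomial ℝ) ∈ polyCone := fun n => by
  rw [coeff_X]; split_ifs <;> norm_num

/-- `1` has nonnegative coefficients. [cite: Sahi2008POAlgebras, §4 (p. 457)] -/
private theorem one_mem_polyCone : (1 : Polynomial ℝ) ∈ polyCone := fun n => by
  rw [coeff_one]; split_ifs <;> norm_num

/-- `0` has nonnegative coefficients. [cite: Sahi2008POAlgebras, §4 (p. 457)] -/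
private theorem zero_mem_polyCone : (0 : Polynomial ℝ) ∈ polyCone := fun n => by simp

/-- The functions `a` of §4 on `2^S`, `|S| = 1`: `a(∅) = x²`, `a(S) = x³ + 2x² + x + 1`.
[cite: Sahi2008POAlgebras, §4 (p. 457)] -/
def adA (α : Finset Unit) : Polynomial ℝ := if α = ∅ then X ^ 2 else X ^ 3 + X ^ 2 + X ^ 2 + X + 1

/-- `b(∅) = 1`, `b(S) = x + 1`. [cite: Sahi2008POAlgebras, §4 (p. 457)] -/
def adB (α : Finset Unit) : Polynomial ℝ := if α = ∅ then 1 else X + 1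

/-- `c = d`: `c(∅) = x`, `c(S) = x² + x + 1`. [cite: Sahi2008POAlgebras, §4 (p. 457)] -/
def adC (α : Finset Unit) : Polynomial ℝ := if α = ∅ then X else X ^ 2 + X + 1

/-- The two subsets of a one-point set. [folklore] -/
private theorem finset_unit_eq (α : Finset Unit) : α = ∅ ∨ α = univ := by
  rcases α.eq_empty_or_nonempty with h | ⟨u, hu⟩
  · exact Or.inl h
  · exact Or.inr (eq_univ_iff_forall.2 fun v => by rwa [Subsingleton.elim v u])

/-- `S ≠ ∅`. [folklore] -/
private theorem univ_ne_empty_unit : (univ : Finset Unit) ≠ ∅ := univ_nonempty.ne_empty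

/-- **§4 (Sahi 2008): the Ahlswede–Daykin four functions theorem FAILS in the partially ordered algebra
`(ℝ[x], polynomials with nonnegative coefficients)`**, already for `|S| = 1`: the `P`-valued functions
`a, b, c, d` (`c = d`) above satisfy the Ahlswede–Daykin hypothesis `a(α ∪ β) b(α ∩ β) − c(α) d(β) ∈ P`
for all `α, β` ("`x² − x² = 0`, `x² + 1`, `x³`"), but `(Σa)(Σb) − (Σc)(Σd) = x³ + x² − x + 1 ∉ P`.
[cite: Sahi2008POAlgebras, §4 (pp. 456–457)] -/
theorem sahi2008b_ahlswedeDaykin_fails :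
    (∀ α, adA α ∈ polyCone ∧ adB α ∈ polyCone ∧ adC α ∈ polyCone) ∧
    (∀ α β, adA (α ∪ β) * adB (α ∩ β) - adC α * adC β ∈ polyCone) ∧
    (∑ α, adA α) * (∑ α, adB α) - (∑ α, adC α) * (∑ α, adC α) ∉ polyCone := by
  have hP := isPOCone_polynomial
  have hne := univ_ne_empty_unit
  -- the eight values
  have a0 : adA ∅ = X ^ 2 := if_pos rfl
  have a1 : adA univ = X ^ 3 + X ^ 2 + X ^ 2 + X + 1 := if_neg hne
  have b0 : adB ∅ = 1 := if_pos rfl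
  have b1 : adB univ = X + 1 := if_neg hne
  have c0 : adC ∅ = X := if_pos rfl
  have c1 : adC univ = X ^ 2 + X + 1 := if_neg hne
  refine ⟨fun α => ?_, fun α β => ?_, ?_⟩
  · rcases finset_unit_eq α with rfl | rfl
    · rw [a0, b0, c0]
      exact ⟨X_pow_mem_polyCone 2, one_mem_polyCone, X_mem_polyCone⟩
    · rw [a1, b1, c1]
      refine ⟨hP.add_mem (hP.add_mem (hP.add_mem (hP.add_mem (X_pow_mem_polyCone 3) (X_pow_mem_polyCone 2))
        (X_pow_mem_polyCone 2)) X_mem_polyCone) one_mem_polyCone, hP.add_mem X_mem_polyCone one_mem_polyCone,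
        hP.add_mem (hP.add_mem (X_pow_mem_polyCone 2) X_mem_polyCone) one_mem_polyCone⟩
  · -- the three (four) Ahlswede–Daykin expressions: `0`, `x² + 1`, `x² + 1`, `x³`
    rcases finset_unit_eq α with rfl | rfl <;> rcases finset_unit_eq β with rfl | rfl
    · rw [union_empty, inter_empty, a0, b0, c0, show (X ^ 2 * 1 - X * X : Polynomial ℝ) = 0 by ring]
      exact zero_mem_polyCone
    · rw [empty_union, empty_inter, a1, b0, c0, c1,
        show ((X ^ 3 + X ^ 2 + X ^ 2 + X + 1) * 1 - X * (X ^ 2 + X + 1) : Polynomial ℝ) = X ^ 2 + 1 by ring]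
      exact hP.add_mem (X_pow_mem_polyCone 2) one_mem_polyCone
    · rw [union_empty, inter_empty, a1, b0, c1, c0,
        show ((X ^ 3 + X ^ 2 + X ^ 2 + X + 1) * 1 - (X ^ 2 + X + 1) * X : Polynomial ℝ) = X ^ 2 + 1 by ring]
      exact hP.add_mem (X_pow_mem_polyCone 2) one_mem_polyCone
    · rw [union_self, inter_self, a1, b1, c1,
        show ((X ^ 3 + X ^ 2 + X ^ 2 + X + 1) * (X + 1) - (X ^ 2 + X + 1) * (X ^ 2 + X + 1) : Polynomial ℝ) =
          X ^ 3 by ring]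
      exact X_pow_mem_polyCone 3
  · -- the conclusion fails: the coefficient of `x` in `x³ + x² − x + 1` is `−1`
    have hu : (univ : Finset (Finset Unit)) = {∅, univ} := by
      ext α
      simp only [mem_univ, mem_insert, mem_singleton, true_iff]
      exact finset_unit_eq α
    have hsum : ∀ F : Finset Unit → Polynomial ℝ, ∑ α, F α = F ∅ + F univ := fun F => by
      rw [hu, sum_pair (Ne.symm hne)]
    rw [hsum, hsum, hsum, a0, a1, b0, b1, c0, c1,
      show ((X ^ 2 + (X ^ 3 + X ^ 2 + X ^ 2 + X + 1)) * (1 + (X + 1)) -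
          (X + (X ^ 2 + X + 1)) * (X + (X ^ 2 + X + 1)) : Polynomial ℝ) = X ^ 3 + X ^ 2 - X + 1 by ring]
    intro h
    have h1 := h 1
    simp only [coeff_add, coeff_sub, coeff_X_pow, coeff_X, coeff_one] at h1
    norm_num at h1

end AhlswedeDaykin

end POAlgebra

end Literature.Probability.LatticeModels
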